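import Mathlib.Analysis.Complex.ExponentialBounds
import Literature.Computability.Complexity.SwitchingLemma
import HarnessLib

/-!
# Håstad's blockwise switching lemma (the second switching lemma, for the Sipser functions), after Thapen

Topic `Literature/Computability/Complexity`, companion of `SwitchingLemma.lean` (Håstad's
switching lemma for the product restrictions `R_p`, Razborov–Beame encoding). This file proves
the switching lemma for the **blockwise** random restrictions with which Håstad separates the
levels of the `AC⁰` depth hierarchy (the restriction spaces `R⁺_{q,B}`, `R⁻_{q,B}` of
*Computational limitations of small-depth circuits*, MIT 1986, Ch. 6, and *Almost optimal lower
bounds for small depth circuits*, STOC 1986 / Adv. Comput. Res. 5 (1989); stated as Lemma 10.4.9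
in Krajíček, *Bounded arithmetic, propositional logic and complexity theory* (1995), §10.4), in
the two-stage form and with the encoding proof of

* N. Thapen, *Notes on switching lemmas*, arXiv:2202.05651 (2022), §2 "A restriction which sets
  variables in blocks", **Lemma 2**.

**The restriction space** (Thapen §2; Håstad's `R⁺_{q,B}` composed with `g(ρ)`). The variables
`Fin n` are partitioned into blocks by `blk : Fin n → β`, and a default bit `dflt` is fixed
(`dflt = 1` is `R⁺`, `dflt = 0` is `R⁻`). A restriction `ρ = (P, Z)` is drawn in two stages:
every variable is put in `P` independently with probability `p` (the variables off `P` are set to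
`dflt`); every block is put in `Z` independently with probability `q` (the *`*`-blocks*; the
variables of `P` in blocks off `Z` are set to `¬dflt`, those in blocks of `Z` are left free).
Its weight is `p^{|P|} (1-p)^{n-|P|} q^{|Z|} (1-q)^{|β|-|Z|}` (`weight`; total weight `1`,
`sum_weight`). The further restriction `g(ρ)` sets, in every `*`-block, every free variable but
the first one to `dflt` (`gPA`).

**The canonical block decision tree** `T(F, ρ)` of an `r`-DNF `F` (Thapen §2): look for the first
term `C` not falsified by the current restriction; for every block containing a free variable of
`C` query its single `g(ρ)`-free variable and set the other free variables of the block to `dflt`;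
stop with `1` when the first live term has no free variable, with `0` when no term is live. Its
height is `bht` (all blocks of a stage are charged); it decides `F|_{ρ g(ρ)}` (`evalDNF_bdnf`,
`eval_bcnf`, packaged as `exists_dnf_of_bht_lt`, `exists_cnf_of_bht_lt`: a DNF and a CNF of width
less than any bound exceeding the height, with pairwise distinct variables all free in `ρ g(ρ)`
(`gPA`, `apply_gPA`), computing `x ↦ F (ρ g(ρ) x)`).

**The lemma** (`blockSwitching`): if the terms of `F` have width `≤ t` and pairwise distinct
variables, `0 ≤ p`, `p ≤ 1/(2(t+1))`, `0 ≤ q ≤ 1/2`, `1 ≤ s`, then the total weight of the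
restrictions `ρ` with `bht ≥ s` is at most `(40 (t+1) q)^s` (Thapen: `(13 q r)^s` under
`p < 1/2r`, `q < 1/13`; Krajíček's statement of Håstad: `(6 q t)^s`; constants not optimised;
the counting form `blockSwitching_count` gives `(4(t+1)+1)^s (1 + (1+p/(1-p))^{t+1})^s (q/(1-q))^s`
for all `0 ≤ p, q < 1`).

**The proof** (Thapen §2, the injection `θ : ρ ↦ (ρσ, β', π', γ')`). A restriction of height `≥ s`
has a canonical path with exactly `s` queried blocks (`exists_path_of_lt_bht`, `truncPathB`). Let
`σ` set, in every queried block, the free variables occurring in the examined term with the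
literal `dflt` to `dflt` (the set `Γ`, "the starred variables which appear positively") and all
other free variables of the block to `¬dflt`: then `ρσ` is again a two-stage restriction — `Γ`
leaves `P` and the `s` queried blocks leave `Z` (`rhoStar`) — of weight
`((1-p)/p)^{|Γ|} ((1-q)/q)^s` times that of `ρ` (`weight_rhoStar`). From `ρσ` and the code — per
queried block the position (`< t`) in the examined term of a literal of that block, a last-in-stage
mark and the answer bit; per stage the `t` flags of the literals whose variables are in `Γ` — the
decoder (`decStageB`, `decPathB`) recovers the examined terms one by one as first live terms of
hybrid restrictions (`firstLive_hybridB`; the untouched blocks are `Pristine`: their fixed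
variables carry `dflt`), hence the blocks, hence (`Γ`-flags and the `¬dflt` values) the set `P` on
those blocks, hence `ρ` (`decStageB_enc`, `decPathB_encPathB`, `eq_of_rhoStar`, `badCodeB_injOn`).
Summing over the injective image, the flags being paid for by the factor `(p/(1-p))^{|Γ|}`
(`flagsB_badCodeB`, `sum_pow_flagsB`: `∑_γ (p/(1-p))^{|γ|} = (1 + p/(1-p))^{t+1} ≤ e` per stage for
`p ≤ 1/(2(t+1))`), gives the bound (`blockSwitching_count`, `blockSwitching`).

Intended consumers: the depth hierarchy theorem for the Sipser functions (Håstad 1986, Ch. 6;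
Krajíček 1995, Lemmas 10.4.7–10.4.11) and, through it, "the polynomial-time hierarchy is infinite
relative to a Cohen-generic oracle" (the named fact
`Literature.Barriers.QuantumAdvantage.isInfinitePHRel_join_generic`, a leaf of Fortnow–Rogers'
Cor. 3.7, `Literature/Barriers/QuantumAdvantage/FortnowRogersOracle.lean`).

## Design notes

* The block structure `blk`, the default bit `dflt` and the DNF `F` are explicit parameters of
  every definition (no `variable`-bound section parameters inside definitions' bodies beyond
  these), and the restriction space is the plain product `Finset (Fin n) × Finset β` with real
  weights, summed with `Finset.sum` (no measure theory), as in `SwitchingLemma.lean`, whose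
  partial assignments `PAssign`, term predicates (`Falsified`, `freeVars`, `firstLive`,
  `VarNodup`) and list coding (`flatL`/`unflatL`) are reused.
* The process state is a `PAssign n`; the designated (`g(ρ)`-free) variable of a block at a state
  is its least free variable (`IsDStar`), which for the blocks not yet queried is the least
  variable of `P` in the block, i.e. Thapen's "first starred variable".
* Thapen marginalises the `Z`-bit of the blocks without `P`-variables; we keep it (it is
  invisible in the restriction), which changes nothing in the argument (the encoding removes the
  queried blocks from `Z`, gaining `(1-q)/q ≥ 1` per block in either case).

## References

* [Thapen2022] N. Thapen, *Notes on switching lemmas*, arXiv:2202.05651, §2, Lemma 2 (held: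
  `lit read arxiv:2202.05651`, chunks p0004–p0005).
* [Krajicek1995] J. Krajíček, *Bounded arithmetic, propositional logic and complexity theory*,
  CUP 1995, Def. 10.4.6 (`R_q^±`, `g(ρ)`), Lemma 10.4.9 (held: `lit read book:krajicek1995-…`,
  chunks p0172–p0174).
* [Hastad1986] J. Håstad, *Computational limitations of small-depth circuits*, PhD thesis, MIT
  1986 (MIT Press 1987), Ch. 6; *Almost optimal lower bounds for small depth circuits*, STOC 1986,
  doi:10.1145/12130.12132 (not held; cited through [Krajicek1995] and [Thapen2022]).
* [Beame1994] P. Beame, *A switching lemma primer*, §3 (the encoding argument), as in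
  `SwitchingLemma.lean`.
-/

noncomputable section

namespace Literature.Computability.Complexity

open Finset PAssign

namespace BlockSwitching

variable {n : ℕ} {β : Type}

/-! ### Two-stage block restrictions -/

section Weight

variable [Fintype β]

/-- A two-stage block restriction `ρ = (P, Z)`: `P` is the set of variables NOT set to the default
bit in the first stage, `Z` the set of `*`-blocks of the second stage. [cite: Thapen2022, §2] -/
abbrev BRestr (n : ℕ) (β : Type) : Type := Finset (Fin n) × Finset β

/-- The weight (probability) of `ρ = (P, Z)`: `p^{|P|} (1-p)^{n-|P|} q^{|Z|} (1-q)^{|β|-|Z|}`.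
[cite: Thapen2022, §2] -/
def weight (p q : ℝ) (ρ : BRestr n β) : ℝ :=
  p ^ ρ.1.card * (1 - p) ^ (n - ρ.1.card) * (q ^ ρ.2.card * (1 - q) ^ (Fintype.card β - ρ.2.card))

/-- Weights are nonnegative for `p, q ∈ [0,1]`. [folklore] -/
theorem weight_nonneg {p q : ℝ} (hp0 : 0 ≤ p) (hp1 : p ≤ 1) (hq0 : 0 ≤ q) (hq1 : q ≤ 1)
    (ρ : BRestr n β) : 0 ≤ weight p q ρ := by
  unfold weight
  have : 0 ≤ 1 - p := by linarith
  have : 0 ≤ 1 - q := by linarith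
  positivity

/-- The two-stage distribution is a probability distribution: total weight `1`. [cite: Thapen2022, §2] -/
theorem sum_weight (p q : ℝ) : ∑ ρ : BRestr n β, weight p q ρ = 1 := by
  rw [Fintype.sum_prod_type]
  simp only [weight]
  have h1 : ∀ P : Finset (Fin n), ∑ Z : Finset β,
      p ^ P.card * (1 - p) ^ (n - P.card) * (q ^ Z.card * (1 - q) ^ (Fintype.card β - Z.card)) =
      p ^ P.card * (1 - p) ^ (n - P.card) := by
    intro P
    rw [← Finset.mul_sum]
    have h := Fintype.sum_pow_mul_eq_add_pow β q (1 - q)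
    rw [add_sub_cancel, one_pow] at h
    rw [h, mul_one]
  simp_rw [h1]
  have h := Fintype.sum_pow_mul_eq_add_pow (Fin n) p (1 - p)
  rwa [Fintype.card_fin, add_sub_cancel, one_pow] at h

end Weight

variable [DecidableEq β] (blk : Fin n → β) (dflt : Bool)

/-- The starred (free) variables of `ρ` before `g`: the variables of `P` lying in `*`-blocks.
[cite: Thapen2022, §2] -/
def starred (ρ : BRestr n β) : Finset (Fin n) := ρ.1.filter fun x => blk x ∈ ρ.2

/-- The restriction `ρ` (before `g`) as a partial assignment: off `P` the default bit, on `P` in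
non-`*`-blocks its negation, free on `P` in `*`-blocks. [cite: Thapen2022, §2] -/
def toPA (ρ : BRestr n β) : PAssign n :=
  ⟨univ \ starred blk ρ, fun x => if x ∈ ρ.1 then !dflt else dflt⟩

/-- The free variables of `toPA ρ` are the starred ones. [cite: Thapen2022, §2] -/
@[simp] theorem free_toPA (ρ : BRestr n β) : (toPA blk dflt ρ).free = starred blk ρ := by
  simp [toPA, PAssign.free, sdiff_sdiff_right_self]

/-- Membership in the starred set. [folklore] -/
theorem mem_starred {ρ : BRestr n β} {x : Fin n} : x ∈ starred blk ρ ↔ x ∈ ρ.1 ∧ blk x ∈ ρ.2 := by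
  simp [starred]

/-- The domain of `toPA ρ`. [folklore] -/
theorem mem_dom_toPA {ρ : BRestr n β} {x : Fin n} : x ∈ (toPA blk dflt ρ).dom ↔ x ∉ starred blk ρ := by
  simp [toPA]

/-- The values of `toPA ρ`. [folklore] -/
@[simp] theorem val_toPA (ρ : BRestr n β) (x : Fin n) :
    (toPA blk dflt ρ).val x = if x ∈ ρ.1 then !dflt else dflt := rfl

/-! ### The block process (Thapen's canonical tree `T(F, ρ)`) -/

/-- `x` is the designated variable of its block at the state `σ`: the least free variable of the
block (for a block not yet queried: the first starred variable, the one `g(ρ)` keeps free).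
[cite: Thapen2022, §2] -/
def IsDStar (σ : PAssign n) (x : Fin n) : Prop := x ∉ σ.dom ∧ ∀ y, y ∉ σ.dom → blk y = blk x → x ≤ y

/-- Decidability of being the designated variable (a finite check). [folklore] -/
instance (σ : PAssign n) (x : Fin n) : Decidable (IsDStar blk σ x) :=
  inferInstanceAs (Decidable (x ∉ σ.dom ∧ ∀ y, y ∉ σ.dom → blk y = blk x → x ≤ y))

/-- The blocks met by the free variables of the term `C` at `σ` (each once). [cite: Thapen2022, §2] -/
def tblocks (σ : PAssign n) (C : Clause (Fin n)) : List β := ((freeVars σ C).map blk).dedup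

/-- The closure of a list of blocks at `σ`: all free variables in those blocks. [cite: Thapen2022, §2] -/
def closure (σ : PAssign n) (L : List β) : Finset (Fin n) := σ.free.filter fun x => blk x ∈ L

/-- One stage of the process: fix the closure of the blocks `L`, the designated variable of each
block receiving the answer `a`, every other free variable of the block the default bit (this is
`g(ρ)` followed by the answers `π`). [cite: Thapen2022, §2] -/
def bnext (σ : PAssign n) (L : List β) (a : Fin n → Bool) : PAssign n :=
  σ.fix (closure blk σ L) fun x => if IsDStar blk σ x then a x else dflt

/-- **Height of the canonical block decision tree** of the DNF `F` from the state `σ` (Thapen's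
`T(F, ρ)` from `σ = toPA ρ`): examine the first live term; if none, or if it has no free variable,
stop; otherwise query the designated variables of all blocks it meets (charging one per block),
fix the closures, and continue on every answer. `fuel` bounds the number of stages. [cite: Thapen2022, §2] -/
def bht : ℕ → CNF (Fin n) → PAssign n → ℕ
  | 0, _, _ => 0
  | fuel + 1, F, σ =>
    match firstLive F σ with
    | none => 0
    | some C =>
      if tblocks blk σ C = [] then 0
      else (tblocks blk σ C).length + univ.sup fun a : Fin n → Bool => bht fuel F (bnext blk dflt σ (tblocks blk σ C) a)

/-! ### Basic facts on closures and stages -/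

variable {blk dflt}

/-- The closure consists of free variables. [folklore] -/
theorem closure_subset_free (σ : PAssign n) (L : List β) : closure blk σ L ⊆ σ.free :=
  Finset.filter_subset _ _

/-- Membership in the closure. [folklore] -/
theorem mem_closure {σ : PAssign n} {L : List β} {x : Fin n} :
    x ∈ closure blk σ L ↔ x ∉ σ.dom ∧ blk x ∈ L := by
  simp [closure, PAssign.mem_free]

/-- The closure is disjoint from the domain. [folklore] -/
theorem closure_disjoint_dom (σ : PAssign n) (L : List β) : Disjoint (closure blk σ L) σ.dom :=
  Finset.disjoint_left.2 fun _ hx => (mem_closure.1 hx).1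

/-- The domain after a stage. [folklore] -/
theorem bnext_dom (σ : PAssign n) (L : List β) (a : Fin n → Bool) :
    (bnext blk dflt σ L a).dom = σ.dom ∪ closure blk σ L := rfl

/-- The free set after a stage: the free variables outside the blocks of `L`. [folklore] -/
theorem free_bnext (σ : PAssign n) (L : List β) (a : Fin n → Bool) :
    (bnext blk dflt σ L a).free = σ.free.filter fun x => blk x ∉ L := by
  rw [bnext, free_fix]
  ext x
  simp only [Finset.mem_sdiff, mem_closure, Finset.mem_filter, PAssign.mem_free]
  tauto

/-- Blocks of `tblocks σ C` are blocks of free variables of `C`. [folklore] -/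
theorem mem_tblocks {σ : PAssign n} {C : Clause (Fin n)} {b : β} :
    b ∈ tblocks blk σ C ↔ ∃ x ∈ freeVars σ C, blk x = b := by
  simp [tblocks, List.mem_dedup]

/-- `tblocks` has no duplicates. [folklore] -/
theorem tblocks_nodup (σ : PAssign n) (C : Clause (Fin n)) : (tblocks blk σ C).Nodup :=
  List.nodup_dedup _

/-- `tblocks σ C = []` iff `C` has no free variable at `σ`. [folklore] -/
theorem tblocks_eq_nil_iff {σ : PAssign n} {C : Clause (Fin n)} : tblocks blk σ C = [] ↔ freeVars σ C = [] := by
  simp [tblocks, List.dedup_eq_nil]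

/-- A stage with a nonempty block list among `tblocks` fixes at least one free variable. [folklore] -/
theorem card_free_bnext_lt {σ : PAssign n} {C : Clause (Fin n)} {L : List β} (hL : L ≠ [])
    (hsub : ∀ b ∈ L, b ∈ tblocks blk σ C) (a : Fin n → Bool) :
    (bnext blk dflt σ L a).free.card < σ.free.card := by
  obtain ⟨b, hb⟩ := List.exists_mem_of_ne_nil L hL
  obtain ⟨x, hx, rfl⟩ := mem_tblocks.1 (hsub b hb)
  have hxfree : x ∈ σ.free := freeVars_subset_free σ C (List.mem_toFinset.2 hx)
  rw [free_bnext]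
  refine Finset.card_lt_card ⟨Finset.filter_subset _ _, fun h => ?_⟩
  have := (Finset.mem_filter.1 (h hxfree)).2
  exact this hb

/-! ### Paths of the block process -/

variable (n β) in
/-- A stage of a path of the block process: the term examined, the blocks queried (in order) and
the answers received by their designated variables (junk elsewhere). [cite: Thapen2022, §2] -/
structure BStage where
  /-- the term examined at this stage -/
  term : Clause (Fin n)
  /-- the blocks queried at this stage -/
  blks : List β
  /-- the answers (junk off the designated variables of `blks`) -/
  ans : Fin n → Bool

/-- The state after a stage. [cite: Thapen2022, §2] -/
def BStage.next (blk : Fin n → β) (dflt : Bool) (σ : PAssign n) (st : BStage n β) : PAssign n :=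
  bnext blk dflt σ st.blks st.ans

/-- A *full* path of the block process of `F` from `σ`: every stage examines the first live term
and queries all the blocks it meets (at least one). [cite: Thapen2022, §2] -/
def BPathValid (blk : Fin n → β) (dflt : Bool) (F : CNF (Fin n)) : PAssign n → List (BStage n β) → Prop
  | _, [] => True
  | σ, st :: rest => firstLive F σ = some st.term ∧ st.blks = tblocks blk σ st.term ∧ st.blks ≠ [] ∧
      BPathValid blk dflt F (st.next blk dflt σ) rest

/-- A path whose *last* stage may query only a (nonempty) prefix of the blocks met by its term
(Thapen: "trim `β_k` and `π_k` to only include the blocks mentioned in the first `s` queries").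
[cite: Thapen2022, §2] -/
def BPathValidLast (blk : Fin n → β) (dflt : Bool) (F : CNF (Fin n)) : PAssign n → List (BStage n β) → Prop
  | _, [] => False
  | σ, [st] => firstLive F σ = some st.term ∧ st.blks <+: tblocks blk σ st.term ∧ st.blks ≠ []
  | σ, st :: st' :: rest => firstLive F σ = some st.term ∧ st.blks = tblocks blk σ st.term ∧ st.blks ≠ [] ∧
      BPathValidLast blk dflt F (st.next blk dflt σ) (st' :: rest)

/-- The number of blocks queried along a path. [folklore] -/
def bplen : List (BStage n β) → ℕ
  | [] => 0
  | st :: rest => st.blks.length + bplen rest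

omit [DecidableEq β] in
/-- The empty path queries no block. [folklore] -/
@[simp] theorem bplen_nil : bplen ([] : List (BStage n β)) = 0 := rfl

omit [DecidableEq β] in
/-- Length of a path, cons case. [folklore] -/
@[simp] theorem bplen_cons (st : BStage n β) (rest : List (BStage n β)) :
    bplen (st :: rest) = st.blks.length + bplen rest := rfl

/-- The blocks queried along a path, in order. [folklore] -/
def bpathBlocks : List (BStage n β) → List β
  | [] => []
  | st :: rest => st.blks ++ bpathBlocks rest

omit [DecidableEq β] in
/-- Blocks of the empty path. [folklore] -/
@[simp] theorem bpathBlocks_nil : bpathBlocks ([] : List (BStage n β)) = [] := rfl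

omit [DecidableEq β] in
/-- Blocks of a path, cons case. [folklore] -/
@[simp] theorem bpathBlocks_cons (st : BStage n β) (rest : List (BStage n β)) :
    bpathBlocks (st :: rest) = st.blks ++ bpathBlocks rest := rfl

omit [DecidableEq β] in
/-- A path queries `bplen` blocks. [folklore] -/
theorem length_bpathBlocks : ∀ P : List (BStage n β), (bpathBlocks P).length = bplen P
  | [] => rfl
  | st :: rest => by simp [length_bpathBlocks rest]

/-- **Long paths exist**: if the block tree of `F` from `σ` has height `> ℓ`, there is a full
path from `σ` querying more than `ℓ` blocks. [cite: Thapen2022, §2] -/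
theorem exists_path_of_lt_bht (F : CNF (Fin n)) : ∀ (fuel : ℕ) (σ : PAssign n) (ℓ : ℕ),
    ℓ < bht blk dflt fuel F σ → ∃ P : List (BStage n β), BPathValid blk dflt F σ P ∧ ℓ < bplen P
  | 0, σ, ℓ, h => by simp [bht] at h
  | fuel + 1, σ, ℓ, h => by
    unfold bht at h
    cases hC : firstLive F σ with
    | none => rw [hC] at h; simp at h
    | some C =>
      rw [hC] at h
      simp only at h
      split_ifs at h with hL
      · simp at h
      by_cases hlen : ℓ < (tblocks blk σ C).length
      · exact ⟨[⟨C, tblocks blk σ C, fun _ => false⟩], ⟨hC, rfl, hL, trivial⟩, by simpa using hlen⟩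
      · push Not at hlen
        have hsup : ℓ - (tblocks blk σ C).length <
            univ.sup (fun a : Fin n → Bool => bht blk dflt fuel F (bnext blk dflt σ (tblocks blk σ C) a)) := by
          omega
        rw [Finset.lt_sup_iff] at hsup
        obtain ⟨a, _, ha⟩ := hsup
        obtain ⟨P, hP, hlenP⟩ := exists_path_of_lt_bht F fuel (bnext blk dflt σ (tblocks blk σ C) a) _ ha
        refine ⟨⟨C, tblocks blk σ C, a⟩ :: P, ⟨hC, rfl, hL, hP⟩, ?_⟩
        simp only [bplen_cons]
        omega

/-- Truncation of a full path to its first `b` queried blocks. [cite: Thapen2022, §2] -/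
def truncPathB : List (BStage n β) → ℕ → List (BStage n β)
  | [], _ => []
  | st :: rest, b =>
    if b ≤ st.blks.length then [{ st with blks := st.blks.take b }]
    else st :: truncPathB rest (b - st.blks.length)

/-- **Truncation**: cutting a full path at `1 ≤ b ≤` its length gives a valid last path with
exactly `b` queried blocks. [cite: Thapen2022, §2] -/
theorem truncPathB_valid {F : CNF (Fin n)} :
    ∀ {σ : PAssign n} {P : List (BStage n β)} {b : ℕ}, BPathValid blk dflt F σ P → 1 ≤ b → b ≤ bplen P →
      BPathValidLast blk dflt F σ (truncPathB P b) ∧ bplen (truncPathB P b) = b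
  | σ, [], b, _, h1, hb => by simp at hb; omega
  | σ, st :: rest, b, ⟨hC, hblks, hne, hrest⟩, h1, hb => by
    unfold truncPathB
    split_ifs with hle
    · refine ⟨⟨hC, ?_, ?_⟩, ?_⟩
      · simp only; rw [hblks]; exact List.take_prefix _ _
      · simp only
        intro h
        have := congrArg List.length h
        rw [List.length_take, List.length_nil] at this
        have : 0 < st.blks.length := List.length_pos_iff.2 hne
        omega
      · simp [List.length_take, Nat.min_eq_left hle]
    · push Not at hle
      have hb' : b - st.blks.length ≤ bplen rest := by simp at hb; omega
      have ih := truncPathB_valid hrest (by omega) hb'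
      have hne' : truncPathB rest (b - st.blks.length) ≠ [] := by
        intro h; have := ih.1; rw [h] at this; exact this
      obtain ⟨st', rest', hrw⟩ := List.exists_cons_of_ne_nil hne'
      refine ⟨?_, ?_⟩
      · rw [hrw]
        refine ⟨hC, hblks, hne, ?_⟩
        rw [← hrw]; exact ih.1
      · simp only [bplen_cons, ih.2]; omega

/-- A valid last path is nonempty. [folklore] -/
theorem BPathValidLast.ne_nil {F : CNF (Fin n)} {σ : PAssign n} {P : List (BStage n β)}
    (h : BPathValidLast blk dflt F σ P) : P ≠ [] := by
  rintro rfl; exact h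

/-- Every stage of a valid last path queries a sublist of the blocks met by its term, which is the
first live term, and at least one block. [cite: Thapen2022, §2] -/
theorem BPathValidLast.head {F : CNF (Fin n)} {σ : PAssign n} {st : BStage n β} {rest : List (BStage n β)}
    (h : BPathValidLast blk dflt F σ (st :: rest)) :
    firstLive F σ = some st.term ∧ st.blks <+: tblocks blk σ st.term ∧ st.blks ≠ [] := by
  cases rest with
  | nil => exact h
  | cons st' rest => exact ⟨h.1, h.2.1 ▸ List.prefix_refl _, h.2.2.1⟩

/-- The tail of a valid last path is a valid last path from the next state (if nonempty). [folklore] -/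
theorem BPathValidLast.tail {F : CNF (Fin n)} {σ : PAssign n} {st st' : BStage n β} {rest : List (BStage n β)}
    (h : BPathValidLast blk dflt F σ (st :: st' :: rest)) :
    BPathValidLast blk dflt F (st.next blk dflt σ) (st' :: rest) := h.2.2.2

/-! ### Freeness and distinctness along a path -/

/-- The blocks of a stage of a valid last path have free variables at its state, hence are
pairwise distinct from the blocks queried later; all queried blocks have a free variable at the
start. [cite: Thapen2022, §2] -/
theorem BPathValidLast.nodup_free {F : CNF (Fin n)} :
    ∀ {σ : PAssign n} {P : List (BStage n β)}, BPathValidLast blk dflt F σ P →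
      (bpathBlocks P).Nodup ∧ ∀ b ∈ bpathBlocks P, ∃ x ∈ σ.free, blk x = b
  | σ, [], h => absurd h id
  | σ, [st], h => by
    obtain ⟨hC, hpre, _⟩ := BPathValidLast.head h
    simp only [bpathBlocks_cons, bpathBlocks_nil, List.append_nil]
    refine ⟨hpre.sublist.nodup (tblocks_nodup σ st.term), fun b hb => ?_⟩
    obtain ⟨x, hx, rfl⟩ := mem_tblocks.1 (hpre.subset hb)
    exact ⟨x, freeVars_subset_free σ st.term (List.mem_toFinset.2 hx), rfl⟩
  | σ, st :: st' :: rest, h => by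
    obtain ⟨hC, hpre, _⟩ := BPathValidLast.head h
    have ih := BPathValidLast.nodup_free (BPathValidLast.tail h)
    have hstfree : ∀ b ∈ st.blks, ∃ x ∈ σ.free, blk x = b := fun b hb => by
      obtain ⟨x, hx, rfl⟩ := mem_tblocks.1 (hpre.subset hb)
      exact ⟨x, freeVars_subset_free σ st.term (List.mem_toFinset.2 hx), rfl⟩
    have hlater : ∀ b ∈ bpathBlocks (st' :: rest), (∃ x ∈ σ.free, blk x = b) ∧ b ∉ st.blks := by
      intro b hb
      obtain ⟨x, hx, rfl⟩ := ih.2 b hb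
      rw [BStage.next, free_bnext, Finset.mem_filter] at hx
      exact ⟨⟨x, hx.1, rfl⟩, hx.2⟩
    refine ⟨?_, fun b hb => ?_⟩
    · rw [bpathBlocks_cons]
      refine List.nodup_append.2 ⟨hpre.sublist.nodup (tblocks_nodup σ st.term), ih.1, ?_⟩
      rintro b hb _ hb' rfl
      exact (hlater b hb').2 hb
    · rw [bpathBlocks_cons, List.mem_append] at hb
      rcases hb with hb | hb
      · exact hstfree b hb
      · exact (hlater b hb).1

/-! ### The block tree decides `F|_{ρ g(ρ)}`: DNFs and CNFs of width at most the height -/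

variable (blk dflt) in
/-- The input seen by `F` at the state `σ` on the total input `x`: fixed variables have their
values, the designated variable of each block reads `x`, the other free variables the default bit
(this is `g` at the state, followed by `x`). [cite: Thapen2022, §2] -/
def eff (σ : PAssign n) (x : Fin n → Bool) : Fin n → Bool :=
  fun v => if v ∈ σ.dom then σ.val v else if IsDStar blk σ v then x v else dflt

variable (blk) in
/-- The designated variables of the blocks of `L` at `σ`, as a sorted list. [cite: Thapen2022, §2] -/
def dstarList (σ : PAssign n) (L : List β) : List (Fin n) :=
  (univ.filter fun v => IsDStar blk σ v ∧ blk v ∈ L).sort (· ≤ ·)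

/-- Membership in `dstarList`. [folklore] -/
theorem mem_dstarList {σ : PAssign n} {L : List β} {v : Fin n} :
    v ∈ dstarList blk σ L ↔ IsDStar blk σ v ∧ blk v ∈ L := by
  simp [dstarList, Finset.mem_sort]

/-- `dstarList` has no duplicates. [folklore] -/
theorem dstarList_nodup (σ : PAssign n) (L : List β) : (dstarList blk σ L).Nodup :=
  Finset.sort_nodup _ _

variable (blk) in
/-- The guard term of the branch with answers `a`: the designated variables of the queried blocks
carry the answers. [cite: Thapen2022, §2] -/
def guardT (σ : PAssign n) (L : List β) (a : Fin n → Bool) : Clause (Fin n) :=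
  (dstarList blk σ L).map fun v => (v, a v)

variable (blk) in
/-- The guard clause of the branch with answers `a` (negated guard term). [cite: Thapen2022, §2] -/
def guardC (σ : PAssign n) (L : List β) (a : Fin n → Bool) : Clause (Fin n) :=
  (dstarList blk σ L).map fun v => (v, !a v)

variable (blk dflt) in
/-- **The DNF read off the block tree** from `σ`: one term per branch ending in `1`, the
conjunction of the answers along the branch. [cite: Thapen2022, §2] -/
def bdnf : ℕ → CNF (Fin n) → PAssign n → CNF (Fin n)
  | 0, _, _ => []
  | fuel + 1, F, σ =>
    match firstLive F σ with
    | none => []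
    | some C =>
      if tblocks blk σ C = [] then [[]]
      else (univ : Finset (Fin n → Bool)).toList.flatMap fun a =>
        (bdnf fuel F (bnext blk dflt σ (tblocks blk σ C) a)).map fun T => guardT blk σ (tblocks blk σ C) a ++ T

variable (blk dflt) in
/-- **The CNF read off the block tree** from `σ`: one clause per branch ending in `0`, the
disjunction of the negated answers along the branch. [cite: Thapen2022, §2] -/
def bcnf : ℕ → CNF (Fin n) → PAssign n → CNF (Fin n)
  | 0, _, _ => [[]]
  | fuel + 1, F, σ =>
    match firstLive F σ with
    | none => [[]]
    | some C =>
      if tblocks blk σ C = [] then []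
      else (univ : Finset (Fin n → Bool)).toList.flatMap fun a =>
        (bcnf fuel F (bnext blk dflt σ (tblocks blk σ C) a)).map fun K => guardC blk σ (tblocks blk σ C) a ++ K

omit [DecidableEq β] in
/-- Designated variables are free. [folklore] -/
theorem IsDStar.not_mem_dom {σ : PAssign n} {v : Fin n} (h : IsDStar blk σ v) : v ∉ σ.dom := h.1

/-- After a stage on the blocks `L`, a variable outside those blocks is designated iff it was. [folklore] -/
theorem isDStar_bnext_iff {σ : PAssign n} {L : List β} {a : Fin n → Bool} {v : Fin n} (hv : blk v ∉ L) :
    IsDStar blk (bnext blk dflt σ L a) v ↔ IsDStar blk σ v := by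
  have hdom : ∀ y, blk y = blk v → (y ∉ (bnext blk dflt σ L a).dom ↔ y ∉ σ.dom) := by
    intro y hy
    rw [bnext_dom, Finset.mem_union, mem_closure, not_or]
    constructor
    · exact fun h => h.1
    · intro h; exact ⟨h, fun h' => hv (hy ▸ h'.2)⟩
  constructor
  · rintro ⟨h1, h2⟩
    exact ⟨(hdom v rfl).1 h1, fun y hy hyb => h2 y ((hdom y hyb).2 hy) hyb⟩
  · rintro ⟨h1, h2⟩
    exact ⟨(hdom v rfl).2 h1, fun y hy hyb => h2 y ((hdom y hyb).1 hy) hyb⟩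

/-- A free variable in a block of `L` is in the domain after the stage on `L`. [folklore] -/
theorem mem_dom_bnext_of_mem {σ : PAssign n} {L : List β} (a : Fin n → Bool) {v : Fin n}
    (hv : blk v ∈ L) : v ∈ (bnext blk dflt σ L a).dom := by
  rw [bnext_dom, Finset.mem_union, mem_closure]
  by_cases h : v ∈ σ.dom
  · exact Or.inl h
  · exact Or.inr ⟨h, hv⟩

/-- **Key invariance**: a stage whose answers agree with `x` on the designated variables of its
blocks does not change the input seen by `F`. [cite: Thapen2022, §2] -/
theorem eff_bnext {σ : PAssign n} {L : List β} {a x : Fin n → Bool}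
    (ha : ∀ v, IsDStar blk σ v → blk v ∈ L → a v = x v) : eff blk dflt (bnext blk dflt σ L a) x = eff blk dflt σ x := by
  funext v
  unfold eff
  by_cases hvd : v ∈ σ.dom
  · have h1 : v ∈ (bnext blk dflt σ L a).dom := by rw [bnext_dom]; exact Finset.mem_union_left _ hvd
    rw [if_pos h1, if_pos hvd, bnext, fix_val, if_neg]
    exact fun hc => (mem_closure.1 hc).1 hvd
  · by_cases hvL : blk v ∈ L
    · have h1 : v ∈ (bnext blk dflt σ L a).dom := mem_dom_bnext_of_mem a hvL
      have hc : v ∈ closure blk σ L := mem_closure.2 ⟨hvd, hvL⟩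
      rw [if_pos h1, if_neg hvd, bnext, fix_val, if_pos hc]
      by_cases hds : IsDStar blk σ v
      · rw [if_pos hds, if_pos hds, ha v hds hvL]
      · rw [if_neg hds, if_neg hds]
    · have h1 : v ∉ (bnext blk dflt σ L a).dom := by
        rw [bnext_dom, Finset.mem_union, mem_closure, not_or]
        exact ⟨hvd, fun h => hvL h.2⟩
      rw [if_neg h1, if_neg hvd]
      exact if_congr (isDStar_bnext_iff hvL) rfl rfl

/-- `eff σ x` extends `σ`. [folklore] -/
theorem eff_of_mem_dom {σ : PAssign n} (x : Fin n → Bool) {v : Fin n} (hv : v ∈ σ.dom) :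
    eff blk dflt σ x v = σ.val v := by
  simp [eff, hv]

/-- A term falsified by `σ` is false under `eff σ x`. [folklore] -/
theorem all_eval_eff_eq_false_of_falsified {σ : PAssign n} {C : Clause (Fin n)} (h : Falsified σ C)
    (x : Fin n → Bool) : C.all (Literal.eval (eff blk dflt σ x)) = false := by
  obtain ⟨l, hl, hd, hv⟩ := h
  rw [List.all_eq_false]
  refine ⟨l, hl, ?_⟩
  simp only [Literal.eval, eff_of_mem_dom x hd]
  simpa using hv

/-- A live term without free variables is true under `eff σ x`. [folklore] -/
theorem all_eval_eff_eq_true_of_live {σ : PAssign n} {C : Clause (Fin n)} (h : ¬ Falsified σ C)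
    (hfree : freeVars σ C = []) (x : Fin n → Bool) : C.all (Literal.eval (eff blk dflt σ x)) = true := by
  rw [List.all_eq_true]
  intro l hl
  have hd : l.1 ∈ σ.dom := by
    by_contra hld
    have : l.1 ∈ freeVars σ C := mem_freeVars.2 ⟨l.2, hl, hld⟩
    rw [hfree] at this; simp at this
  have hv : σ.val l.1 = l.2 := by
    by_contra hne; exact h ⟨l, hl, hd, hne⟩
  simp [Literal.eval, eff_of_mem_dom x hd, hv]

/-- The guard term of `a` is true at `x` iff `a` agrees with `x` on the designated variables of the
queried blocks. [folklore] -/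
theorem all_eval_guardT_iff {σ : PAssign n} {L : List β} {a x : Fin n → Bool} :
    (guardT blk σ L a).all (Literal.eval x) = true ↔ ∀ v, IsDStar blk σ v → blk v ∈ L → a v = x v := by
  simp only [guardT, List.all_map, List.all_eq_true, Function.comp, Literal.eval, beq_iff_eq,
    mem_dstarList, and_imp]
  exact ⟨fun h v hv hL => (h v hv hL).symm, fun h v hv hL => (h v hv hL).symm⟩

/-- The guard clause of `a` is true at `x` iff `a` disagrees with `x` on some designated variable of
the queried blocks. [folklore] -/
theorem any_eval_guardC_iff {σ : PAssign n} {L : List β} {a x : Fin n → Bool} :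
    (guardC blk σ L a).any (Literal.eval x) = true ↔ ∃ v, IsDStar blk σ v ∧ blk v ∈ L ∧ a v ≠ x v := by
  simp only [guardC, List.any_map, List.any_eq_true, Function.comp, Literal.eval, beq_iff_eq, mem_dstarList]
  constructor
  · rintro ⟨v, ⟨hv, hL⟩, he⟩
    refine ⟨v, hv, hL, fun h => ?_⟩
    rw [h] at he
    cases hx : x v <;> simp [hx] at he
  · rintro ⟨v, hv, hL, hne⟩
    refine ⟨v, ⟨hv, hL⟩, ?_⟩
    cases ha : a v <;> cases hx : x v <;> simp_all

/-- A `flatMap` of DNFs is true iff one of them is. [folklore] -/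
theorem evalDNF_flatMap_iff {α : Type} (l : List α) (f : α → CNF (Fin n)) (x : Fin n → Bool) :
    CNF.evalDNF (l.flatMap f) x = true ↔ ∃ a ∈ l, (f a).evalDNF x = true := by
  simp only [CNF.evalDNF, List.any_flatMap, List.any_eq_true]

/-- Prefixing every term by a guard term. [folklore] -/
theorem evalDNF_map_append_iff (G : Clause (Fin n)) (D : CNF (Fin n)) (x : Fin n → Bool) :
    CNF.evalDNF (D.map fun T => G ++ T) x = true ↔ G.all (Literal.eval x) = true ∧ D.evalDNF x = true := by
  simp only [CNF.evalDNF, List.any_map, List.any_eq_true, Function.comp, List.all_append,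
    Bool.and_eq_true]
  constructor
  · rintro ⟨T, hT, hG, hTx⟩; exact ⟨hG, T, hT, hTx⟩
  · rintro ⟨hG, T, hT, hTx⟩; exact ⟨T, hT, hG, hTx⟩

/-- A `flatMap` of CNFs is true iff all of them are. [folklore] -/
theorem eval_flatMap_iff {α : Type} (l : List α) (f : α → CNF (Fin n)) (x : Fin n → Bool) :
    CNF.eval (l.flatMap f) x = true ↔ ∀ a ∈ l, (f a).eval x = true := by
  simp only [CNF.eval, List.all_flatMap, List.all_eq_true]

/-- Prefixing every clause by a guard clause. [folklore] -/
theorem eval_map_append_iff (G : Clause (Fin n)) (D : CNF (Fin n)) (x : Fin n → Bool) :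
    CNF.eval (D.map fun K => G ++ K) x = true ↔ G.any (Literal.eval x) = true ∨ D.eval x = true := by
  simp only [CNF.eval, List.all_map, List.all_eq_true, Function.comp, List.any_append, Bool.or_eq_true]
  constructor
  · intro h
    by_cases hG : G.any (Literal.eval x) = true
    · exact Or.inl hG
    · exact Or.inr fun K hK => (h K hK).resolve_left hG
  · rintro (hG | hD) K hK
    · exact Or.inl hG
    · exact Or.inr (hD K hK)

/-- `evalDNF` as an existential. [folklore] -/
theorem evalDNF_eq_true_iff (F : CNF (Fin n)) (y : Fin n → Bool) :
    F.evalDNF y = true ↔ ∃ C ∈ F, C.all (Literal.eval y) = true := by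
  simp only [CNF.evalDNF, List.any_eq_true]

/-- **The DNF of the block tree computes `F` on the seen input**, given enough fuel (more than the
number of free variables). [cite: Thapen2022, §2] -/
theorem evalDNF_bdnf (F : CNF (Fin n)) : ∀ (fuel : ℕ) (σ : PAssign n), σ.free.card < fuel →
    ∀ x : Fin n → Bool, (bdnf blk dflt fuel F σ).evalDNF x = F.evalDNF (eff blk dflt σ x)
  | 0, σ, h, x => by omega
  | fuel + 1, σ, hfuel, x => by
    unfold bdnf
    cases hC : firstLive F σ with
    | none =>
      simp only [CNF.evalDNF, List.any_nil]
      symm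
      rw [List.any_eq_false]
      intro C hCF
      have hf : Falsified σ C := firstLive_eq_none_iff.1 hC C hCF
      simp [all_eval_eff_eq_false_of_falsified hf x]
    | some C =>
      simp only
      have hlive := (firstLive_eq_some_iff.1 hC).1
      have hCF : C ∈ F := mem_of_firstLive hC
      split_ifs with hL
      · have hfree : freeVars σ C = [] := tblocks_eq_nil_iff.1 hL
        simp only [CNF.evalDNF, List.any_cons, List.all_nil, List.any_nil, Bool.or_false]
        symm
        rw [List.any_eq_true]
        exact ⟨C, hCF, all_eval_eff_eq_true_of_live hlive hfree x⟩
      · rw [Bool.eq_iff_iff, evalDNF_flatMap_iff]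
        constructor
        · rintro ⟨a, -, ha'⟩
          rw [evalDNF_map_append_iff] at ha'
          obtain ⟨hguard, hD⟩ := ha'
          have ha := all_eval_guardT_iff.1 hguard
          have hlt : (bnext blk dflt σ (tblocks blk σ C) a).free.card < fuel :=
            lt_of_lt_of_le (card_free_bnext_lt hL (fun b hb => hb) a) (by omega)
          have ih := evalDNF_bdnf F fuel (bnext blk dflt σ (tblocks blk σ C) a) hlt x
          rw [eff_bnext ha] at ih
          rw [← ih]
          exact hD
        · intro hF
          have hlt : (bnext blk dflt σ (tblocks blk σ C) x).free.card < fuel :=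
            lt_of_lt_of_le (card_free_bnext_lt hL (fun b hb => hb) x) (by omega)
          have ih := evalDNF_bdnf F fuel (bnext blk dflt σ (tblocks blk σ C) x) hlt x
          rw [eff_bnext (fun v _ _ => rfl)] at ih
          refine ⟨x, Finset.mem_toList.2 (Finset.mem_univ x), ?_⟩
          rw [evalDNF_map_append_iff, ih]
          exact ⟨all_eval_guardT_iff.2 fun v _ _ => rfl, hF⟩

/-- **The CNF of the block tree computes `F` on the seen input**, given enough fuel. [cite: Thapen2022, §2] -/
theorem eval_bcnf (F : CNF (Fin n)) : ∀ (fuel : ℕ) (σ : PAssign n), σ.free.card < fuel →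
    ∀ x : Fin n → Bool, (bcnf blk dflt fuel F σ).eval x = F.evalDNF (eff blk dflt σ x)
  | 0, σ, h, x => by omega
  | fuel + 1, σ, hfuel, x => by
    unfold bcnf
    cases hC : firstLive F σ with
    | none =>
      simp only [CNF.eval, List.all_cons, List.any_nil, List.all_nil, Bool.and_true, CNF.evalDNF]
      symm
      rw [List.any_eq_false]
      intro C hCF
      have hf : Falsified σ C := firstLive_eq_none_iff.1 hC C hCF
      simp [all_eval_eff_eq_false_of_falsified hf x]
    | some C =>
      simp only
      have hlive := (firstLive_eq_some_iff.1 hC).1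
      have hCF : C ∈ F := mem_of_firstLive hC
      split_ifs with hL
      · have hfree : freeVars σ C = [] := tblocks_eq_nil_iff.1 hL
        simp only [CNF.eval, List.all_nil, CNF.evalDNF]
        symm
        rw [List.any_eq_true]
        exact ⟨C, hCF, all_eval_eff_eq_true_of_live hlive hfree x⟩
      · rw [Bool.eq_iff_iff, eval_flatMap_iff]
        constructor
        · intro h
          have hx := h x (Finset.mem_toList.2 (Finset.mem_univ x))
          rw [eval_map_append_iff] at hx
          rcases hx with hg | hD
          · obtain ⟨v, _, _, hne⟩ := any_eval_guardC_iff.1 hg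
            exact absurd rfl hne
          · have hlt : (bnext blk dflt σ (tblocks blk σ C) x).free.card < fuel :=
              lt_of_lt_of_le (card_free_bnext_lt hL (fun b hb => hb) x) (by omega)
            have ih := eval_bcnf F fuel (bnext blk dflt σ (tblocks blk σ C) x) hlt x
            rw [eff_bnext (fun v _ _ => rfl)] at ih
            rw [← ih]
            exact hD
        · intro hF a _
          rw [eval_map_append_iff]
          by_cases hagree : ∀ v, IsDStar blk σ v → blk v ∈ tblocks blk σ C → a v = x v
          · right
            have hlt : (bnext blk dflt σ (tblocks blk σ C) a).free.card < fuel :=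
              lt_of_lt_of_le (card_free_bnext_lt hL (fun b hb => hb) a) (by omega)
            have ih := eval_bcnf F fuel (bnext blk dflt σ (tblocks blk σ C) a) hlt x
            rw [eff_bnext hagree] at ih
            rw [ih]
            exact hF
          · left
            push Not at hagree
            obtain ⟨v, hv, hL', hne⟩ := hagree
            exact any_eval_guardC_iff.2 ⟨v, hv, hL', hne⟩

/-- The designated variables of the blocks of a duplicate-free list number at most its length
(one designated variable per block). [folklore] -/
theorem length_dstarList_le {σ : PAssign n} {L : List β} :
    (dstarList blk σ L).length ≤ L.length := by
  have hinj : ∀ v ∈ dstarList blk σ L, ∀ w ∈ dstarList blk σ L, blk v = blk w → v = w := by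
    intro v hv w hw he
    obtain ⟨⟨hv1, hv2⟩, _⟩ := mem_dstarList.1 hv
    obtain ⟨⟨hw1, hw2⟩, _⟩ := mem_dstarList.1 hw
    exact le_antisymm (hv2 w hw1 he.symm) (hw2 v hv1 he)
  calc (dstarList blk σ L).length = ((dstarList blk σ L).map blk).length := (List.length_map _).symm
    _ ≤ L.length := by
      refine List.Subperm.length_le ?_
      refine List.subperm_of_subset ?_ fun b hb => ?_
      · exact (List.nodup_map_iff_inj_on (dstarList_nodup (blk := blk) σ L)).2 hinj
      · obtain ⟨v, hv, rfl⟩ := List.mem_map.1 hb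
        exact (mem_dstarList.1 hv).2

/-- **Width of the DNF**: every term of `bdnf` has at most `bht` literals (same fuel). [cite: Thapen2022, §2] -/
theorem length_le_bht_of_mem_bdnf (F : CNF (Fin n)) : ∀ (fuel : ℕ) (σ : PAssign n),
    ∀ T ∈ bdnf blk dflt fuel F σ, T.length ≤ bht blk dflt fuel F σ
  | 0, σ, T, hT => by simp [bdnf] at hT
  | fuel + 1, σ, T, hT => by
    unfold bdnf at hT; unfold bht
    cases hC : firstLive F σ with
    | none => rw [hC] at hT; simp at hT
    | some C =>
      rw [hC] at hT
      simp only at hT ⊢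
      split_ifs at hT ⊢ with hL
      · simp at hT; simp [hT]
      · simp only [List.mem_flatMap, Finset.mem_toList, Finset.mem_univ, true_and, List.mem_map] at hT
        obtain ⟨a, T', hT', rfl⟩ := hT
        rw [List.length_append]
        have h1 : (guardT blk σ (tblocks blk σ C) a).length ≤ (tblocks blk σ C).length := by
          rw [guardT, List.length_map]; exact length_dstarList_le
        have h2 := length_le_bht_of_mem_bdnf F fuel _ T' hT'
        have h3 : bht blk dflt fuel F (bnext blk dflt σ (tblocks blk σ C) a) ≤
            univ.sup fun a : Fin n → Bool => bht blk dflt fuel F (bnext blk dflt σ (tblocks blk σ C) a) :=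
          Finset.le_sup (f := fun a : Fin n → Bool => bht blk dflt fuel F (bnext blk dflt σ (tblocks blk σ C) a))
            (Finset.mem_univ a)
        omega

/-- **Width of the CNF**: every clause of `bcnf` has at most `bht` literals (same fuel). [cite: Thapen2022, §2] -/
theorem length_le_bht_of_mem_bcnf (F : CNF (Fin n)) : ∀ (fuel : ℕ) (σ : PAssign n),
    ∀ K ∈ bcnf blk dflt fuel F σ, K.length ≤ bht blk dflt fuel F σ
  | 0, σ, K, hK => by simp [bcnf] at hK; simp [hK]
  | fuel + 1, σ, K, hK => by
    unfold bcnf at hK; unfold bht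
    cases hC : firstLive F σ with
    | none => rw [hC] at hK; simp at hK; simp [hK]
    | some C =>
      rw [hC] at hK
      simp only at hK ⊢
      split_ifs at hK ⊢ with hL
      · simp at hK
      · simp only [List.mem_flatMap, Finset.mem_toList, Finset.mem_univ, true_and, List.mem_map] at hK
        obtain ⟨a, K', hK', rfl⟩ := hK
        rw [List.length_append]
        have h1 : (guardC blk σ (tblocks blk σ C) a).length ≤ (tblocks blk σ C).length := by
          rw [guardC, List.length_map]; exact length_dstarList_le
        have h2 := length_le_bht_of_mem_bcnf F fuel _ K' hK'
        have h3 : bht blk dflt fuel F (bnext blk dflt σ (tblocks blk σ C) a) ≤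
            univ.sup fun a : Fin n → Bool => bht blk dflt fuel F (bnext blk dflt σ (tblocks blk σ C) a) :=
          Finset.le_sup (f := fun a : Fin n → Bool => bht blk dflt fuel F (bnext blk dflt σ (tblocks blk σ C) a))
            (Finset.mem_univ a)
        omega

/-- A designated variable after a stage was designated before it. [folklore] -/
theorem IsDStar.of_bnext {σ : PAssign n} {L : List β} {a : Fin n → Bool} {v : Fin n}
    (h : IsDStar blk (bnext blk dflt σ L a) v) : IsDStar blk σ v ∧ blk v ∉ L := by
  have hvL : blk v ∉ L := fun hL => h.1 (mem_dom_bnext_of_mem a hL)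
  exact ⟨(isDStar_bnext_iff hvL).1 h, hvL⟩

/-- **Variables of the DNF**: every literal of `bdnf` is on a variable designated at the start, and
the terms have pairwise distinct variables. [cite: Thapen2022, §2] -/
theorem vars_bdnf (F : CNF (Fin n)) : ∀ (fuel : ℕ) (σ : PAssign n),
    ∀ T ∈ bdnf blk dflt fuel F σ, VarNodup T ∧ ∀ l ∈ T, IsDStar blk σ l.1
  | 0, σ, T, hT => by simp [bdnf] at hT
  | fuel + 1, σ, T, hT => by
    unfold bdnf at hT
    cases hC : firstLive F σ with
    | none => rw [hC] at hT; simp at hT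
    | some C =>
      rw [hC] at hT
      simp only at hT
      split_ifs at hT with hL
      · simp only [List.mem_singleton] at hT
        subst hT
        exact ⟨List.nodup_nil, by simp⟩
      · simp only [List.mem_flatMap, Finset.mem_toList, Finset.mem_univ, true_and, List.mem_map] at hT
        obtain ⟨a, T', hT', rfl⟩ := hT
        obtain ⟨ihnd, ihds⟩ := vars_bdnf F fuel _ T' hT'
        refine ⟨?_, fun l hl => ?_⟩
        · unfold VarNodup
          rw [List.map_append]
          refine List.nodup_append.2 ⟨?_, ihnd, ?_⟩
          · rw [guardT, List.map_map]
            exact (dstarList_nodup (blk := blk) σ _).map fun v w h => by simpa using h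
          · intro v hv w hw hvw
            subst hvw
            rw [guardT, List.map_map, List.mem_map] at hv
            obtain ⟨v', hv', rfl⟩ := hv
            obtain ⟨l, hl, hlv⟩ := List.mem_map.1 hw
            have h1 := (mem_dstarList.1 hv').2
            have h2 := (ihds l hl).of_bnext
            simp only [Function.comp] at hlv
            rw [hlv] at h2
            exact h2.2 h1
        · rcases List.mem_append.1 hl with hl | hl
          · rw [guardT, List.mem_map] at hl
            obtain ⟨v, hv, rfl⟩ := hl
            exact (mem_dstarList.1 hv).1
          · exact (ihds l hl).of_bnext.1

/-- **Variables of the CNF**: every literal of `bcnf` is on a variable designated at the start, and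
the clauses have pairwise distinct variables. [cite: Thapen2022, §2] -/
theorem vars_bcnf (F : CNF (Fin n)) : ∀ (fuel : ℕ) (σ : PAssign n),
    ∀ K ∈ bcnf blk dflt fuel F σ, VarNodup K ∧ ∀ l ∈ K, IsDStar blk σ l.1
  | 0, σ, K, hK => by
    simp only [bcnf, List.mem_singleton] at hK
    subst hK
    exact ⟨List.nodup_nil, by simp⟩
  | fuel + 1, σ, K, hK => by
    unfold bcnf at hK
    cases hC : firstLive F σ with
    | none =>
      rw [hC] at hK
      simp only [List.mem_singleton] at hK
      subst hK
      exact ⟨List.nodup_nil, by simp⟩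
    | some C =>
      rw [hC] at hK
      simp only at hK
      split_ifs at hK with hL
      · simp at hK
      · simp only [List.mem_flatMap, Finset.mem_toList, Finset.mem_univ, true_and, List.mem_map] at hK
        obtain ⟨a, K', hK', rfl⟩ := hK
        obtain ⟨ihnd, ihds⟩ := vars_bcnf F fuel _ K' hK'
        refine ⟨?_, fun l hl => ?_⟩
        · unfold VarNodup
          rw [List.map_append]
          refine List.nodup_append.2 ⟨?_, ihnd, ?_⟩
          · rw [guardC, List.map_map]
            exact (dstarList_nodup (blk := blk) σ _).map fun v w h => by simpa using h
          · intro v hv w hw hvw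
            subst hvw
            rw [guardC, List.map_map, List.mem_map] at hv
            obtain ⟨v', hv', rfl⟩ := hv
            obtain ⟨l, hl, hlv⟩ := List.mem_map.1 hw
            have h1 := (mem_dstarList.1 hv').2
            have h2 := (ihds l hl).of_bnext
            simp only [Function.comp] at hlv
            rw [hlv] at h2
            exact h2.2 h1
        · rcases List.mem_append.1 hl with hl | hl
          · rw [guardC, List.mem_map] at hl
            obtain ⟨v, hv, rfl⟩ := hl
            exact (mem_dstarList.1 hv).1
          · exact (ihds l hl).of_bnext.1

/-! ### Untouched blocks are pristine -/

variable (blk dflt) in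
/-- **Pristine states**: in a block that still has a free variable, every fixed variable carries
the default bit. True for `toPA ρ` (the fixed variables of a `*`-block are those off `P`) and
preserved by the stages (a queried block has no free variable left). [cite: Thapen2022, §2] -/
def Pristine (σ : PAssign n) : Prop :=
  ∀ x y : Fin n, blk x = blk y → y ∉ σ.dom → x ∈ σ.dom → σ.val x = dflt

/-- `toPA ρ` is pristine. [cite: Thapen2022, §2] -/
theorem pristine_toPA (ρ : BRestr n β) : Pristine blk dflt (toPA blk dflt ρ) := by
  intro x y hxy hy hx
  rw [mem_dom_toPA, not_not, mem_starred] at hy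
  rw [mem_dom_toPA, mem_starred, not_and] at hx
  have hxP : x ∉ ρ.1 := fun h => hx h (hxy ▸ hy.2)
  simp [toPA, hxP]

/-- Stages preserve pristineness. [cite: Thapen2022, §2] -/
theorem Pristine.bnext {σ : PAssign n} (h : Pristine blk dflt σ) (L : List β) (a : Fin n → Bool) :
    Pristine blk dflt (bnext blk dflt σ L a) := by
  intro x y hxy hy hx
  have hy' : y ∉ σ.dom ∧ blk y ∉ L := by
    rw [bnext_dom, Finset.mem_union, mem_closure, not_or] at hy
    exact ⟨hy.1, fun h' => hy.2 ⟨hy.1, h'⟩⟩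
  have hxc : x ∉ closure blk σ L := fun hc => hy'.2 (hxy ▸ (mem_closure.1 hc).2)
  have hxd : x ∈ σ.dom := by
    rw [bnext_dom, Finset.mem_union] at hx
    exact hx.resolve_right hxc
  show (σ.fix (closure blk σ L) _).val x = dflt
  rw [fix_val, if_neg hxc]
  exact h x y hxy hy'.1 hxd

/-! ### Thapen's `σ` and the restriction `ρσ` -/

variable (blk dflt) in
/-- Thapen's values `σ₁ ⋯ σ_k` along a path: a variable of a queried block gets the default bit if
it occurs in the examined term of its stage with the literal `dflt` ("appears positively"), and
`¬dflt` otherwise (junk `¬dflt` off the queried blocks). [cite: Thapen2022, §2] -/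
def sigmaVal : List (BStage n β) → Fin n → Bool
  | [] => fun _ => !dflt
  | st :: rest => fun x =>
    if blk x ∈ st.blks then (if (x, dflt) ∈ st.term then dflt else !dflt) else sigmaVal rest x

variable (blk) in
/-- The closure of all blocks queried along a path, at `σ`. [cite: Thapen2022, §2] -/
def pclosure (σ : PAssign n) (P : List (BStage n β)) : Finset (Fin n) := closure blk σ (bpathBlocks P)

variable (blk dflt) in
/-- The set `Γ` of a path from `σ`: the free variables of the queried blocks which `σ` sets to the
default bit (Thapen's `γ₁, …, γ_k`: "the starred variables from the blocks in `βᵢ` which appear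
positively in `Cᵢ`"). [cite: Thapen2022, §2] -/
def gammaSet (σ : PAssign n) (P : List (BStage n β)) : Finset (Fin n) :=
  (pclosure blk σ P).filter fun x => sigmaVal blk dflt P x = dflt

variable (blk dflt) in
/-- **The restriction `ρσ`** as a two-stage restriction: `Γ` leaves `P` (its variables now carry
the default bit) and the queried blocks leave `Z` (they have no free variable left).
[cite: Thapen2022, §2] -/
def rhoStar (ρ : BRestr n β) (P : List (BStage n β)) : BRestr n β :=
  (ρ.1 \ gammaSet blk dflt (toPA blk dflt ρ) P, ρ.2 \ (bpathBlocks P).toFinset)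

/-- `sigmaVal` on a block of the first stage. [folklore] -/
theorem sigmaVal_cons_of_mem {st : BStage n β} {rest : List (BStage n β)} {x : Fin n} (hx : blk x ∈ st.blks) :
    sigmaVal blk dflt (st :: rest) x = if (x, dflt) ∈ st.term then dflt else !dflt := by
  simp [sigmaVal, hx]

/-- `sigmaVal` off the blocks of the first stage. [folklore] -/
theorem sigmaVal_cons_of_not_mem {st : BStage n β} {rest : List (BStage n β)} {x : Fin n}
    (hx : blk x ∉ st.blks) : sigmaVal blk dflt (st :: rest) x = sigmaVal blk dflt rest x := by
  simp [sigmaVal, hx]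

/-- Membership in `pclosure`. [folklore] -/
theorem mem_pclosure {σ : PAssign n} {P : List (BStage n β)} {x : Fin n} :
    x ∈ pclosure blk σ P ↔ x ∉ σ.dom ∧ blk x ∈ bpathBlocks P := mem_closure

/-- The closure of the empty path is empty. [folklore] -/
@[simp] theorem pclosure_nil (σ : PAssign n) : pclosure blk σ ([] : List (BStage n β)) = ∅ := by
  ext x; simp [mem_pclosure]

/-- **Splitting the closure of a path** at its first stage (blocks pairwise distinct): the closure
of the first stage and, disjointly, the closure of the rest at the next state. [folklore] -/
theorem pclosure_cons {σ : PAssign n} {st : BStage n β} {rest : List (BStage n β)}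
    (hnd : (bpathBlocks (st :: rest)).Nodup) :
    pclosure blk σ (st :: rest) = closure blk σ st.blks ∪ pclosure blk (st.next blk dflt σ) rest ∧
      Disjoint (closure blk σ st.blks) (pclosure blk (st.next blk dflt σ) rest) := by
  rw [bpathBlocks_cons] at hnd
  have hdisj := List.disjoint_of_nodup_append hnd
  have key : ∀ x, x ∈ pclosure blk (st.next blk dflt σ) rest ↔ x ∉ σ.dom ∧ blk x ∈ bpathBlocks rest := by
    intro x
    rw [mem_pclosure, BStage.next, bnext_dom, Finset.mem_union, mem_closure, not_or]
    constructor
    · rintro ⟨⟨h1, _⟩, h2⟩; exact ⟨h1, h2⟩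
    · rintro ⟨h1, h2⟩; exact ⟨⟨h1, fun h => hdisj h.2 h2⟩, h2⟩
  constructor
  · ext x
    rw [Finset.mem_union, mem_pclosure, mem_closure, key, bpathBlocks_cons, List.mem_append]
    tauto
  · rw [Finset.disjoint_left]
    intro x hx hx'
    exact hdisj (mem_closure.1 hx).2 ((key x).1 hx').2

/-- `fix` only depends on the values on the fixed set. [folklore] -/
theorem fix_congr (σ : PAssign n) (S : Finset (Fin n)) {a a' : Fin n → Bool} (h : ∀ i ∈ S, a i = a' i) :
    σ.fix S a = σ.fix S a' := by
  ext i
  · rfl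
  · simp only [fix_val]; split_ifs with hi
    · exact h i hi
    · rfl

/-- **`ρσ` as a hybrid partial assignment**: `toPA (ρσ)` is `toPA ρ` extended on the closure of
the queried blocks by Thapen's `σ`-values. [cite: Thapen2022, §2] -/
theorem toPA_rhoStar (ρ : BRestr n β) (P : List (BStage n β)) :
    toPA blk dflt (rhoStar blk dflt ρ P) =
      (toPA blk dflt ρ).fix (pclosure blk (toPA blk dflt ρ) P) (sigmaVal blk dflt P) := by
  have hΓ : ∀ x, x ∈ gammaSet blk dflt (toPA blk dflt ρ) P ↔
      x ∈ pclosure blk (toPA blk dflt ρ) P ∧ sigmaVal blk dflt P x = dflt := fun x => Finset.mem_filter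
  have hpc : ∀ x, x ∈ pclosure blk (toPA blk dflt ρ) P ↔ (x ∈ ρ.1 ∧ blk x ∈ ρ.2) ∧ blk x ∈ bpathBlocks P := by
    intro x; rw [mem_pclosure, mem_dom_toPA, not_not, mem_starred]
  ext x
  · rw [mem_dom_toPA, fix_dom, Finset.mem_union, mem_dom_toPA, mem_starred, mem_starred]
    simp only [rhoStar, Finset.mem_sdiff, List.mem_toFinset, hΓ, hpc]
    tauto
  · rw [val_toPA, fix_val, val_toPA]
    simp only [rhoStar, Finset.mem_sdiff, hΓ]
    by_cases hx : x ∈ pclosure blk (toPA blk dflt ρ) P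
    · have hx1 : x ∈ ρ.1 := ((hpc x).1 hx).1.1
      rw [if_pos hx]
      by_cases hv : sigmaVal blk dflt P x = dflt
      · rw [hv]; simp [hx, hx1]
      · rw [if_pos ⟨hx1, fun h => hv h.2⟩]
        cases hd : dflt <;> cases hs : sigmaVal blk dflt P x <;> simp_all
    · rw [if_neg hx]
      by_cases hx1 : x ∈ ρ.1
      · rw [if_pos ⟨hx1, fun h => hx h.1⟩, if_pos hx1]
      · rw [if_neg (fun h => hx1 h.1), if_neg hx1]

/-- `Γ ⊆ pclosure ⊆ starred ⊆ P`. [folklore] -/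
theorem gammaSet_subset (ρ : BRestr n β) (P : List (BStage n β)) :
    gammaSet blk dflt (toPA blk dflt ρ) P ⊆ ρ.1 := by
  intro x hx
  have hx' := (Finset.mem_filter.1 hx).1
  rw [mem_pclosure, mem_dom_toPA, not_not, mem_starred] at hx'
  exact hx'.1.1

/-- **Recovering `ρ` from `ρσ` and the decoded sets**: `P = P* ∪ pclosure`, `Z = Z* ∪ {queried blocks}`
(the latter as soon as the queried blocks are `*`-blocks, e.g. along a valid path). [cite: Thapen2022, §2] -/
theorem eq_of_rhoStar (ρ : BRestr n β) (P : List (BStage n β)) (hZ : ∀ b ∈ bpathBlocks P, b ∈ ρ.2) :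
    ρ = ((rhoStar blk dflt ρ P).1 ∪ pclosure blk (toPA blk dflt ρ) P,
      (rhoStar blk dflt ρ P).2 ∪ (bpathBlocks P).toFinset) := by
  ext x
  · simp only [rhoStar, Finset.mem_union, Finset.mem_sdiff]
    constructor
    · intro hx
      by_cases hg : x ∈ gammaSet blk dflt (toPA blk dflt ρ) P
      · exact Or.inr (Finset.mem_filter.1 hg).1
      · exact Or.inl ⟨hx, hg⟩
    · rintro (⟨hx, _⟩ | hx)
      · exact hx
      · have := (mem_pclosure.1 hx).1
        rw [mem_dom_toPA, not_not, mem_starred] at this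
        exact this.1
  · simp only [rhoStar, Finset.mem_union, Finset.mem_sdiff, List.mem_toFinset]
    constructor
    · intro hx
      by_cases hb : x ∈ bpathBlocks P
      · exact Or.inr hb
      · exact Or.inl ⟨hx, hb⟩
    · rintro (⟨hx, _⟩ | hx)
      · exact hx
      · exact hZ x hx

/-- **Weight transfer** `w(ρσ) = ((1-p)/p)^{|Γ|} ((1-q)/q)^s w(ρ)` for a path of `s` distinct
`*`-blocks (stated multiplicatively). [cite: Thapen2022, §2] -/
theorem weight_rhoStar [Fintype β] (p q : ℝ) (ρ : BRestr n β) (P : List (BStage n β))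
    (hnd : (bpathBlocks P).Nodup) (hZ : ∀ b ∈ bpathBlocks P, b ∈ ρ.2) :
    (1 - p) ^ (gammaSet blk dflt (toPA blk dflt ρ) P).card * (1 - q) ^ (bpathBlocks P).length * weight p q ρ =
      p ^ (gammaSet blk dflt (toPA blk dflt ρ) P).card * q ^ (bpathBlocks P).length *
        weight p q (rhoStar blk dflt ρ P) := by
  set g := (gammaSet blk dflt (toPA blk dflt ρ) P).card with hg
  set s := (bpathBlocks P).length with hs
  have hΓsub := gammaSet_subset (blk := blk) (dflt := dflt) ρ P
  have hTsub : (bpathBlocks P).toFinset ⊆ ρ.2 := fun b hb => hZ b (List.mem_toFinset.1 hb)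
  have hTcard : (bpathBlocks P).toFinset.card = s := List.toFinset_card_of_nodup hnd
  have h1 : (rhoStar blk dflt ρ P).1.card = ρ.1.card - g := by
    rw [rhoStar, Finset.card_sdiff_of_subset hΓsub]
  have h2 : (rhoStar blk dflt ρ P).2.card = ρ.2.card - s := by
    rw [rhoStar, Finset.card_sdiff_of_subset hTsub, hTcard]
  have hg1 : g ≤ ρ.1.card := Finset.card_le_card hΓsub
  have hs2 : s ≤ ρ.2.card := hTcard ▸ Finset.card_le_card hTsub
  have hP : ρ.1.card ≤ n := by simpa using Finset.card_le_univ ρ.1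
  have hZc : ρ.2.card ≤ Fintype.card β := Finset.card_le_univ ρ.2
  obtain ⟨a, ha⟩ : ∃ a, ρ.1.card = a + g := ⟨ρ.1.card - g, by omega⟩
  obtain ⟨b, hb⟩ : ∃ b, ρ.2.card = b + s := ⟨ρ.2.card - s, by omega⟩
  have h1' : (rhoStar blk dflt ρ P).1.card = a := by rw [h1, ha]; omega
  have h2' : (rhoStar blk dflt ρ P).2.card = b := by rw [h2, hb]; omega
  unfold weight
  rw [h1', h2', ha, hb]
  have e1 : n - a = (n - (a + g)) + g := by omega
  have e2 : Fintype.card β - b = (Fintype.card β - (b + s)) + s := by omega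
  rw [e1, e2]
  simp only [pow_add]
  ring

/-! ### Encoding and decoding of a path -/

variable (blk) in
/-- The position in the term `C` of its first literal on a variable of the block `b`
(`C.length` if none). [cite: Thapen2022, §2] -/
def posB (C : Clause (Fin n)) (b : β) : ℕ := C.findIdx fun l => blk l.1 = b

variable (blk) in
/-- **The letters of a stage** at the state `σ`: for each queried block (listed through its
designated variable), the position in the examined term of a literal of that block (a number
`< t`) and the answer bit. [cite: Thapen2022, §2] -/
def encStageB (t : ℕ) (σ : PAssign n) (st : BStage n β) : List (Fin (t + 1) × Bool) :=
  (dstarList blk σ st.blks).map fun v => (⟨min (posB blk st.term (blk v)) t, by omega⟩, st.ans v)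

variable (blk dflt) in
/-- **The flags of a stage** (Thapen's `γ'ᵢ`): the positions in the examined term of the literals
`(x, dflt)` with `x` free in a queried block, i.e. of the variables of `Γ` of the stage. [cite: Thapen2022, §2] -/
def gcode (t : ℕ) (σ : PAssign n) (st : BStage n β) : Finset (Fin (t + 1)) :=
  univ.filter fun j => ∃ h : j.val < st.term.length,
    (st.term[j.val]).1 ∈ closure blk σ st.blks ∧ (st.term[j.val]).2 = dflt

variable (blk dflt) in
/-- The code of a path: letters and flags, stage by stage. [cite: Thapen2022, §2] -/
def encPathB (t : ℕ) : PAssign n → List (BStage n β) → List (List (Fin (t + 1) × Bool) × Finset (Fin (t + 1)))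
  | _, [] => []
  | σ, st :: rest => (encStageB blk t σ st, gcode blk dflt t σ st) :: encPathB t (st.next blk dflt σ) rest

variable (blk) in
/-- The block read off a letter: the block of the literal at the recorded position. [cite: Thapen2022, §2] -/
def blOf (t : ℕ) (C : Clause (Fin n)) (e : Fin (t + 1) × Bool) : Option β :=
  (C[e.1.val]?).map fun l => blk l.1

variable (blk) in
/-- The queried blocks read off the letters of a stage. [cite: Thapen2022, §2] -/
def decBlocks (t : ℕ) (C : Clause (Fin n)) (ls : List (Fin (t + 1) × Bool)) : Finset β :=
  (ls.filterMap (blOf blk t C)).toFinset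

/-- The set `Γ` of a stage read off its flags. [cite: Thapen2022, §2] -/
def decGamma (t : ℕ) (C : Clause (Fin n)) (S : Finset (Fin (t + 1))) : Finset (Fin n) :=
  univ.filter fun x => ∃ j ∈ S, (C[j.val]?).map Prod.fst = some x

variable (blk dflt) in
/-- The recovered free set of the queried blocks: `Γ` together with the variables valued `¬dflt`
("setting all variables mentioned in `γ₁` to `*` and all `0`s in `ρσ₁|B` to `*`"). [cite: Thapen2022, §2] -/
def decW (t : ℕ) (C : Clause (Fin n)) (η : PAssign n) (ls : List (Fin (t + 1) × Bool))
    (S : Finset (Fin (t + 1))) : Finset (Fin n) :=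
  univ.filter fun x => blk x ∈ decBlocks blk t C ls ∧ (x ∈ decGamma t C S ∨ η.val x = !dflt)

variable (blk dflt) in
/-- The answer bit read off the letters for the block `b`. [cite: Thapen2022, §2] -/
def decAns (t : ℕ) (C : Clause (Fin n)) (ls : List (Fin (t + 1) × Bool)) (b : β) : Bool :=
  match ls.find? (fun e => blOf blk t C e = some b) with
  | some e => e.2
  | none => dflt

variable (blk dflt) in
/-- The values `πᵢ` replacing `σᵢ`: the least variable of the recovered free set in each block gets
the answer bit, the others the default bit. [cite: Thapen2022, §2] -/
def decPi (t : ℕ) (C : Clause (Fin n)) (Wd : Finset (Fin n)) (ls : List (Fin (t + 1) × Bool)) : Fin n → Bool :=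
  fun x => if ∀ y ∈ Wd, blk y = blk x → x ≤ y then decAns blk dflt t C ls (blk x) else dflt

variable (blk dflt) in
/-- **One stage of the decoder.** From the hybrid restriction `η` (Thapen's `ρ π₁⋯π_{i-1} σᵢ⋯σ_k`),
the letters and the flags of the stage: the examined term is the first live term of `η`; the
letters give the queried blocks; the flags give `Γ` on them, which together with the variables
valued `¬dflt` is the set of variables that were free (`P`) on those blocks; the designated
variables (least free ones) receive the answer bits and the others the default bit, turning `σᵢ`
into `πᵢ`. Returns the recovered free set, the queried blocks and the next hybrid restriction.
[cite: Thapen2022, §2] -/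
def decStageB (t : ℕ) (F : CNF (Fin n)) (η : PAssign n) (ls : List (Fin (t + 1) × Bool))
    (S : Finset (Fin (t + 1))) : Finset (Fin n) × Finset β × PAssign n :=
  match firstLive F η with
  | none => (∅, ∅, η)
  | some C =>
    (decW blk dflt t C η ls S, decBlocks blk t C ls,
      η.setVals (decW blk dflt t C η ls S) (decPi blk dflt t C (decW blk dflt t C η ls S) ls))

variable (blk dflt) in
/-- **The decoder**: the union of the recovered free sets and of the queried blocks along the code.
[cite: Thapen2022, §2] -/
def decPathB (t : ℕ) (F : CNF (Fin n)) :
    PAssign n → List (List (Fin (t + 1) × Bool) × Finset (Fin (t + 1))) → Finset (Fin n) × Finset β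
  | _, [] => (∅, ∅)
  | η, c :: rest =>
    ((decStageB blk dflt t F η c.1 c.2).1 ∪ (decPathB t F (decStageB blk dflt t F η c.1 c.2).2.2 rest).1,
      (decStageB blk dflt t F η c.1 c.2).2.1 ∪ (decPathB t F (decStageB blk dflt t F η c.1 c.2).2.2 rest).2)

/-! ### Correctness of one decoding stage -/

/-- **Hybrid first live term**: extending `σ` on free variables by values that make every free
literal of the first live term on those variables true keeps it the first live term. [cite: Beame1994, §3] [cite: Thapen2022, §2] -/
theorem firstLive_hybridB {F : CNF (Fin n)} {σ : PAssign n} {C : Clause (Fin n)} {V : Finset (Fin n)}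
    {sv : Fin n → Bool} (hC : firstLive F σ = some C) (hV : V ⊆ σ.free)
    (hsv : ∀ l ∈ C, l.1 ∉ σ.dom → l.1 ∈ V → sv l.1 = l.2) : firstLive F (σ.fix V sv) = some C := by
  refine firstLive_transfer hC (fun T hT => hT.fix hV sv) ?_
  rintro ⟨l, hl, hdom, hval⟩
  rw [fix_val] at hval
  have hnot := (firstLive_eq_some_iff.1 hC).1
  by_cases hlV : l.1 ∈ V
  · rw [if_pos hlV] at hval
    exact hval (hsv l hl (mem_free.1 (hV hlV)) hlV)
  · rw [if_neg hlV] at hval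
    rw [fix_dom, Finset.mem_union] at hdom
    rcases hdom with hd | hd
    · exact hnot ⟨l, hl, hd, hval⟩
    · exact hlV hd

omit [DecidableEq β] in
/-- A Boolean different from `dflt` is `!dflt`. [folklore] -/
theorem eq_not_of_ne {b : Bool} (h : b ≠ dflt) : b = !dflt := by
  cases b <;> cases dflt <;> simp_all

omit [DecidableEq β] in
/-- In a term with pairwise distinct variables, a literal `(x, b)` with `b ≠ dflt` excludes the
literal `(x, dflt)`. [folklore] -/
theorem not_mem_of_mem_of_ne {C : Clause (Fin n)} (hC : VarNodup C) {l : Literal (Fin n)} (hl : l ∈ C)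
    (hne : l.2 ≠ dflt) : (l.1, dflt) ∉ C := fun h =>
  hne (by have := hC.eq_of_mem hl h rfl; rw [this])

omit [DecidableEq β] in
/-- The `σ`-rule of a stage satisfies the literals of its term. [cite: Thapen2022, §2] -/
theorem stageRule_eq {C : Clause (Fin n)} (hC : VarNodup C) {l : Literal (Fin n)} (hl : l ∈ C) :
    (if (l.1, dflt) ∈ C then dflt else !dflt) = l.2 := by
  by_cases h2 : l.2 = dflt
  · rw [if_pos (by rw [← h2]; exact hl), h2]
  · rw [if_neg (not_mem_of_mem_of_ne hC hl h2), eq_not_of_ne h2]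

/-- The first literal of `C` on the block `b` sits at position `posB C b < |C|` and is on the block
`b`, as soon as `C` has a literal on `b`. [folklore] -/
theorem posB_spec {C : Clause (Fin n)} {b : β} (h : ∃ l ∈ C, blk l.1 = b) :
    ∃ hlt : posB blk C b < C.length, blk (C[posB blk C b]'hlt).1 = b := by
  obtain ⟨l, hl, hlb⟩ := h
  have hlt : posB blk C b < C.length := by
    unfold posB
    rw [List.findIdx_lt_length]
    exact ⟨l, hl, by simp [hlb]⟩
  refine ⟨hlt, ?_⟩
  have := List.findIdx_getElem (xs := C) (p := fun l : Literal (Fin n) => decide (blk l.1 = b)) (w := hlt)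
  exact of_decide_eq_true this

/-- A block met by the term has a literal of the term on it. [folklore] -/
theorem exists_lit_of_mem_tblocks {σ : PAssign n} {C : Clause (Fin n)} {b : β} (hb : b ∈ tblocks blk σ C) :
    ∃ l ∈ C, blk l.1 = b := by
  obtain ⟨x, hx, rfl⟩ := mem_tblocks.1 hb
  obtain ⟨b', hb', _⟩ := mem_freeVars.1 hx
  exact ⟨(x, b'), hb', rfl⟩

omit [DecidableEq β] in
/-- Every block with a free variable has a designated variable. [folklore] -/
theorem exists_isDStar {σ : PAssign n} {b : β} (h : ∃ x, x ∉ σ.dom ∧ blk x = b) :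
    ∃ v, IsDStar blk σ v ∧ blk v = b := by
  classical
  obtain ⟨x, hx, hxb⟩ := h
  set S : Finset (Fin n) := univ.filter fun y => y ∉ σ.dom ∧ blk y = b with hS
  have hne : S.Nonempty := ⟨x, by simp [hS, hx, hxb]⟩
  have hvb : blk (S.min' hne) = b := (Finset.mem_filter.1 (Finset.min'_mem S hne)).2.2
  refine ⟨S.min' hne, ⟨?_, fun y hy hyb => ?_⟩, hvb⟩
  · exact (Finset.mem_filter.1 (Finset.min'_mem S hne)).2.1
  · exact Finset.min'_le S y (Finset.mem_filter.2 ⟨Finset.mem_univ _, hy, hyb.trans hvb⟩)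

omit [DecidableEq β] in
/-- Designated variables of the same block coincide. [folklore] -/
theorem IsDStar.unique {σ : PAssign n} {v w : Fin n} (hv : IsDStar blk σ v) (hw : IsDStar blk σ w)
    (h : blk v = blk w) : v = w :=
  le_antisymm (hv.2 w hw.1 h.symm) (hw.2 v hv.1 h)

/-- The block read off the letter of a designated variable of a queried block is its block. [cite: Thapen2022, §2] -/
theorem blOf_enc {t : ℕ} {σ : PAssign n} {st : BStage n β} (ht : st.term.length ≤ t)
    (hsub : ∀ b ∈ st.blks, b ∈ tblocks blk σ st.term) {v : Fin n} (hv : v ∈ dstarList blk σ st.blks) :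
    blOf blk t st.term (⟨min (posB blk st.term (blk v)) t, by omega⟩, st.ans v) = some (blk v) := by
  have hvb := (mem_dstarList.1 hv).2
  obtain ⟨hlt, hb⟩ := posB_spec (exists_lit_of_mem_tblocks (hsub _ hvb))
  unfold blOf
  simp only
  rw [Nat.min_eq_left (by omega), List.getElem?_eq_getElem hlt, Option.map_some, hb]

/-- The blocks read off the letters of a stage are the queried blocks. [cite: Thapen2022, §2] -/
theorem decBlocks_enc {t : ℕ} {σ : PAssign n} {st : BStage n β} (ht : st.term.length ≤ t)
    (hsub : ∀ b ∈ st.blks, b ∈ tblocks blk σ st.term) :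
    decBlocks blk t st.term (encStageB blk t σ st) = st.blks.toFinset := by
  ext b
  rw [decBlocks, List.mem_toFinset, List.mem_toFinset]
  simp only [encStageB, List.filterMap_map, List.mem_filterMap, Function.comp]
  constructor
  · rintro ⟨v, hv, he⟩
    rw [blOf_enc ht hsub hv] at he
    cases he
    exact (mem_dstarList.1 hv).2
  · intro hb
    obtain ⟨x, hx, hxb⟩ := mem_tblocks.1 (hsub b hb)
    obtain ⟨_, _, hxd⟩ := mem_freeVars.1 hx
    obtain ⟨v, hv, hvb⟩ := exists_isDStar (σ := σ) ⟨x, hxd, hxb⟩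
    have hvmem : v ∈ dstarList blk σ st.blks := mem_dstarList.2 ⟨hv, hvb ▸ hb⟩
    exact ⟨v, hvmem, by rw [blOf_enc ht hsub hvmem, hvb]⟩

/-- The answer read off the letters for a queried block is the answer of its designated variable. [cite: Thapen2022, §2] -/
theorem decAns_enc {t : ℕ} {σ : PAssign n} {st : BStage n β} (ht : st.term.length ≤ t)
    (hsub : ∀ b ∈ st.blks, b ∈ tblocks blk σ st.term) {x : Fin n} (hx : IsDStar blk σ x) (hxb : blk x ∈ st.blks) :
    decAns blk dflt t st.term (encStageB blk t σ st) (blk x) = st.ans x := by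
  have hxmem : x ∈ dstarList blk σ st.blks := mem_dstarList.2 ⟨hx, hxb⟩
  unfold decAns
  rw [encStageB, List.find?_map]
  cases hf : (dstarList blk σ st.blks).find?
      ((fun e : Fin (t + 1) × Bool => decide (blOf blk t st.term e = some (blk x))) ∘
        fun v => ((⟨min (posB blk st.term (blk v)) t, by omega⟩, st.ans v) : Fin (t + 1) × Bool)) with
  | none =>
    exfalso
    rw [List.find?_eq_none] at hf
    have := hf x hxmem
    simp only [Function.comp, blOf_enc ht hsub hxmem, decide_true] at this
    simp at this
  | some v =>
    simp only [Option.map_some]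
    have hv := List.find?_some hf
    have hvmem : v ∈ dstarList blk σ st.blks := List.mem_of_find?_eq_some hf
    simp only [Function.comp, blOf_enc ht hsub hvmem, Option.some.injEq, decide_eq_true_eq] at hv
    rw [IsDStar.unique (mem_dstarList.1 hvmem).1 hx hv]

/-- The flags of a stage decode to `Γ` of the stage. [cite: Thapen2022, §2] -/
theorem mem_decGamma_enc {t : ℕ} {σ : PAssign n} {st : BStage n β} (ht : st.term.length ≤ t) {x : Fin n} :
    x ∈ decGamma t st.term (gcode blk dflt t σ st) ↔ x ∈ closure blk σ st.blks ∧ (x, dflt) ∈ st.term := by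
  rw [decGamma, Finset.mem_filter]
  simp only [Finset.mem_univ, true_and]
  constructor
  · rintro ⟨j, hj, hjx⟩
    obtain ⟨hlt, h1, h2⟩ := (Finset.mem_filter.1 hj).2
    rw [List.getElem?_eq_getElem hlt, Option.map_some, Option.some.injEq] at hjx
    subst hjx
    refine ⟨h1, ?_⟩
    have : st.term[j.val] = ((st.term[j.val]).1, dflt) := by ext <;> simp [h2]
    rw [← this]; exact List.getElem_mem hlt
  · rintro ⟨h1, h2⟩
    obtain ⟨k, hk, hkx⟩ := List.getElem_of_mem h2
    refine ⟨⟨k, by omega⟩, Finset.mem_filter.2 ⟨Finset.mem_univ _, hk, by simp [hkx, h1], by simp [hkx]⟩, ?_⟩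
    simp [List.getElem?_eq_getElem hk, hkx]

/-- **Decoding one stage** (the heart of the injectivity): from the hybrid restriction
`σ ⊕_{W ∪ U'} sv` — `W` the closure of the stage's blocks, `U'` the later variables, `sv` the
`σ`-rule on `W` — with the stage's letters and flags, the decoder returns `W`, the stage's blocks,
and the hybrid restriction of the next stage `(st.next σ) ⊕_{U'} sv`. [cite: Thapen2022, §2] -/
theorem decStageB_enc {t : ℕ} {F : CNF (Fin n)} (hF : ∀ C ∈ F, VarNodup C) (ht : ∀ C ∈ F, C.length ≤ t)
    {σ : PAssign n} {st : BStage n β} (hpr : Pristine blk dflt σ) (hC : firstLive F σ = some st.term)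
    (hsub : ∀ b ∈ st.blks, b ∈ tblocks blk σ st.term) {U' : Finset (Fin n)} (hU' : U' ⊆ σ.free)
    (hdisj : Disjoint (closure blk σ st.blks) U')
    (hfull : ∀ l ∈ st.term, l.1 ∉ σ.dom → l.1 ∉ U') {sv : Fin n → Bool}
    (hsv : ∀ x ∈ closure blk σ st.blks, sv x = if (x, dflt) ∈ st.term then dflt else !dflt) :
    decStageB blk dflt t F (σ.fix (closure blk σ st.blks ∪ U') sv) (encStageB blk t σ st) (gcode blk dflt t σ st) =
      (closure blk σ st.blks, st.blks.toFinset, (st.next blk dflt σ).fix U' sv) := by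
  set C := st.term with hCdef
  set W := closure blk σ st.blks with hWdef
  have hCF : C ∈ F := mem_of_firstLive hC
  have hnd : VarNodup C := hF C hCF
  have hCt : C.length ≤ t := ht C hCF
  have hWfree : W ⊆ σ.free := closure_subset_free σ _
  have hV : W ∪ U' ⊆ σ.free := Finset.union_subset hWfree hU'
  -- the first live term of the hybrid restriction is the term of the stage
  have hfl : firstLive F (σ.fix (W ∪ U') sv) = some C := by
    refine firstLive_hybridB hC hV fun l hl hld hlV => ?_
    rcases Finset.mem_union.1 hlV with hlW | hlU
    · rw [hsv l.1 hlW]; exact stageRule_eq hnd hl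
    · exact absurd hlU (hfull l hl hld)
  -- the recovered free set is the closure
  have hWdec : decW blk dflt t C (σ.fix (W ∪ U') sv) (encStageB blk t σ st) (gcode blk dflt t σ st) = W := by
    ext x
    rw [decW, Finset.mem_filter, decBlocks_enc hCt hsub, List.mem_toFinset, mem_decGamma_enc hCt, fix_val]
    simp only [Finset.mem_univ, true_and, Finset.mem_union]
    constructor
    · rintro ⟨hxb, h | h⟩
      · exact h.1
      · by_contra hxW
        have hxU : x ∉ U' := fun hxU => hxW (mem_closure.2 ⟨mem_free.1 (hU' hxU), hxb⟩)
        rw [if_neg (fun h' => h'.elim hxW hxU)] at h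
        have hxd : x ∈ σ.dom := by
          by_contra hxd; exact hxW (mem_closure.2 ⟨hxd, hxb⟩)
        obtain ⟨y, hy, hyb⟩ := mem_tblocks.1 (hsub _ hxb)
        obtain ⟨_, _, hyd⟩ := mem_freeVars.1 hy
        rw [hpr x y hyb.symm hyd hxd] at h
        cases dflt <;> simp at h
    · intro hxW
      refine ⟨(mem_closure.1 hxW).2, ?_⟩
      by_cases hxC : (x, dflt) ∈ C
      · exact Or.inl ⟨hxW, hxC⟩
      · right
        rw [if_pos (Or.inl hxW), hsv x hxW, if_neg hxC]
  -- the values `π` on the closure are those of the stage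
  have hpi : σ.fix W (decPi blk dflt t C W (encStageB blk t σ st)) = st.next blk dflt σ := by
    rw [BStage.next, bnext]
    refine fix_congr σ W fun x hxW => ?_
    have hxb := (mem_closure.1 hxW).2
    have hds : (∀ y ∈ W, blk y = blk x → x ≤ y) ↔ IsDStar blk σ x := by
      constructor
      · intro h
        exact ⟨(mem_closure.1 hxW).1, fun y hy hyb => h y (mem_closure.2 ⟨hy, hyb ▸ hxb⟩) hyb⟩
      · intro h y hy hyb
        exact h.2 y (mem_closure.1 hy).1 hyb
    unfold decPi
    by_cases hx : IsDStar blk σ x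
    · rw [if_pos (hds.2 hx), if_pos hx]
      exact decAns_enc hCt hsub hx hxb
    · rw [if_neg (fun h => hx (hds.1 h)), if_neg hx]
  -- assemble
  unfold decStageB
  rw [hfl]
  simp only
  rw [hWdec, decBlocks_enc hCt hsub, setVals_fix Finset.subset_union_left, hpi]
  have hUeq : (W ∪ U') \ W = U' := by
    rw [Finset.union_sdiff_left, Finset.sdiff_eq_self_iff_disjoint]
    exact hdisj.symm
  rw [hUeq]

/-! ### Correctness of the decoder along a path -/

/-- `sigmaVal` follows the `σ`-rule of the first stage on its closure. [folklore] -/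
theorem sigmaVal_closure {σ : PAssign n} {st : BStage n β} {rest : List (BStage n β)} {x : Fin n}
    (hx : x ∈ closure blk σ st.blks) :
    sigmaVal blk dflt (st :: rest) x = if (x, dflt) ∈ st.term then dflt else !dflt :=
  sigmaVal_cons_of_mem (mem_closure.1 hx).2

/-- **The decoder inverts the encoder** along a valid last path from a pristine state: it returns
the closure of the queried blocks and the set of queried blocks. [cite: Thapen2022, §2] -/
theorem decPathB_encPathB {t : ℕ} {F : CNF (Fin n)} (hF : ∀ C ∈ F, VarNodup C) (ht : ∀ C ∈ F, C.length ≤ t) :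
    ∀ {σ : PAssign n} {P : List (BStage n β)}, BPathValidLast blk dflt F σ P → Pristine blk dflt σ →
      decPathB blk dflt t F (σ.fix (pclosure blk σ P) (sigmaVal blk dflt P)) (encPathB blk dflt t σ P) =
        (pclosure blk σ P, (bpathBlocks P).toFinset)
  | σ, [], h, _ => absurd h id
  | σ, st :: rest, h, hpr => by
    have hnd := (BPathValidLast.nodup_free h).1
    obtain ⟨hC, hpre, hne⟩ := BPathValidLast.head h
    have hsub : ∀ b ∈ st.blks, b ∈ tblocks blk σ st.term := fun b hb => hpre.subset hb
    obtain ⟨hsplit, hdisj⟩ := pclosure_cons (blk := blk) (dflt := dflt) (σ := σ) hnd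
    have hU'free : pclosure blk (st.next blk dflt σ) rest ⊆ σ.free := by
      intro x hx
      have := (mem_pclosure.1 hx).1
      rw [BStage.next, bnext_dom, Finset.mem_union, not_or] at this
      exact mem_free.2 this.1
    have hfull : ∀ l ∈ st.term, l.1 ∉ σ.dom → l.1 ∉ pclosure blk (st.next blk dflt σ) rest := by
      intro l hl hld hlU
      cases rest with
      | nil => rw [pclosure_nil] at hlU; simp at hlU
      | cons st' rest' =>
        have hfulleq : st.blks = tblocks blk σ st.term := h.2.1
        have hlb : blk l.1 ∈ st.blks := by
          rw [hfulleq]; exact mem_tblocks.2 ⟨l.1, mem_freeVars.2 ⟨l.2, hl, hld⟩, rfl⟩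
        exact Finset.disjoint_left.1 hdisj (mem_closure.2 ⟨hld, hlb⟩) hlU
    have hstep := decStageB_enc hF ht hpr hC hsub hU'free hdisj hfull
      (sv := sigmaVal blk dflt (st :: rest)) (fun x hx => sigmaVal_closure hx)
    have hcongr : (st.next blk dflt σ).fix (pclosure blk (st.next blk dflt σ) rest) (sigmaVal blk dflt (st :: rest)) =
        (st.next blk dflt σ).fix (pclosure blk (st.next blk dflt σ) rest) (sigmaVal blk dflt rest) := by
      refine fix_congr _ _ fun x hx => sigmaVal_cons_of_not_mem fun hxb => ?_
      rw [bpathBlocks_cons] at hnd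
      exact List.disjoint_of_nodup_append hnd hxb (mem_pclosure.1 hx).2
    rw [hsplit, encPathB, decPathB, hstep]
    simp only
    rw [hcongr]
    cases rest with
    | nil => simp [decPathB, encPathB]
    | cons st' rest' =>
      rw [decPathB_encPathB hF ht (BPathValidLast.tail h) (hpr.bnext st.blks st.ans)]
      simp [List.toFinset_append]

/-! ### Lengths of the codes -/

/-- The designated variables of distinct queried blocks, each with a free variable, are as many as
the blocks. [folklore] -/
theorem length_dstarList_eq {σ : PAssign n} {L : List β} (hL : L.Nodup) (hfree : ∀ b ∈ L, ∃ x, x ∉ σ.dom ∧ blk x = b) :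
    (dstarList blk σ L).length = L.length := by
  refine le_antisymm length_dstarList_le ?_
  have hsub : L ⊆ (dstarList blk σ L).map blk := by
    intro b hb
    obtain ⟨v, hv, hvb⟩ := exists_isDStar (hfree b hb)
    exact List.mem_map.2 ⟨v, mem_dstarList.2 ⟨hv, hvb ▸ hb⟩, hvb⟩
  calc L.length ≤ ((dstarList blk σ L).map blk).length := (List.subperm_of_subset hL hsub).length_le
    _ = (dstarList blk σ L).length := List.length_map _

/-- A stage of a valid last path has as many letters as queried blocks. [cite: Thapen2022, §2] -/
theorem length_encStageB {t : ℕ} {σ : PAssign n} {st : BStage n β} (hnd : st.blks.Nodup)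
    (hsub : ∀ b ∈ st.blks, b ∈ tblocks blk σ st.term) : (encStageB blk t σ st).length = st.blks.length := by
  rw [encStageB, List.length_map]
  refine length_dstarList_eq hnd fun b hb => ?_
  obtain ⟨x, hx, hxb⟩ := mem_tblocks.1 (hsub b hb)
  obtain ⟨_, _, hxd⟩ := mem_freeVars.1 hx
  exact ⟨x, hxd, hxb⟩

/-- Along a valid last path: one code entry per stage, every stage's letter list is nonempty, and
the letters are as many as the queried blocks. [cite: Thapen2022, §2] -/
theorem encPathB_shape {t : ℕ} {F : CNF (Fin n)} :
    ∀ {σ : PAssign n} {P : List (BStage n β)}, BPathValidLast blk dflt F σ P →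
      (encPathB blk dflt t σ P).length = P.length ∧ P.length ≤ bplen P ∧
        (∀ c ∈ encPathB blk dflt t σ P, c.1 ≠ []) ∧
        (flatL ((encPathB blk dflt t σ P).map Prod.fst)).length = bplen P
  | σ, [], h => absurd h id
  | σ, st :: rest, h => by
    obtain ⟨hC, hpre, hne⟩ := BPathValidLast.head h
    have hsub : ∀ b ∈ st.blks, b ∈ tblocks blk σ st.term := fun b hb => hpre.subset hb
    have hlen := length_encStageB (t := t) (hpre.sublist.nodup (tblocks_nodup σ st.term)) hsub
    have hpos : 0 < st.blks.length := List.length_pos_iff.2 hne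
    have hne' : encStageB blk t σ st ≠ [] := by
      intro h0; rw [h0, List.length_nil] at hlen; omega
    have hrest : (encPathB blk dflt t (st.next blk dflt σ) rest).length = rest.length ∧ rest.length ≤ bplen rest ∧
        (∀ c ∈ encPathB blk dflt t (st.next blk dflt σ) rest, c.1 ≠ []) ∧
        (flatL ((encPathB blk dflt t (st.next blk dflt σ) rest).map Prod.fst)).length = bplen rest := by
      cases rest with
      | nil => simp [encPathB, flatL]
      | cons st' rest' => exact encPathB_shape (BPathValidLast.tail h)
    obtain ⟨ih1, ih2, ih3, ih4⟩ := hrest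
    refine ⟨?_, ?_, ?_, ?_⟩
    · simp only [encPathB, List.length_cons, ih1]
    · simp only [List.length_cons, bplen_cons]; omega
    · intro c hc
      simp only [encPathB, List.mem_cons] at hc
      rcases hc with rfl | hc
      · exact hne'
      · exact ih3 c hc
    · simp only [encPathB, List.map_cons, flatL, List.length_append, length_markLast, bplen_cons, ih4, hlen]

/-! ### `Γ` is counted by the flags -/

/-- The `Γ` of a path splits along its first stage. [folklore] -/
theorem gammaSet_cons {σ : PAssign n} {st : BStage n β} {rest : List (BStage n β)}
    (hnd : (bpathBlocks (st :: rest)).Nodup) :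
    gammaSet blk dflt σ (st :: rest) =
      (closure blk σ st.blks).filter (fun x => (x, dflt) ∈ st.term) ∪ gammaSet blk dflt (st.next blk dflt σ) rest ∧
    Disjoint ((closure blk σ st.blks).filter fun x => (x, dflt) ∈ st.term) (gammaSet blk dflt (st.next blk dflt σ) rest) := by
  obtain ⟨hsplit, hdisj⟩ := pclosure_cons (blk := blk) (dflt := dflt) (σ := σ) hnd
  have hnd' := hnd
  rw [bpathBlocks_cons] at hnd'
  have hdj := List.disjoint_of_nodup_append hnd'
  constructor
  · ext x
    rw [gammaSet, hsplit, Finset.filter_union, Finset.mem_union, Finset.mem_union, gammaSet]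
    constructor
    · rintro (hx | hx)
      · left
        rw [Finset.mem_filter] at hx ⊢
        refine ⟨hx.1, ?_⟩
        have := hx.2
        rw [sigmaVal_closure hx.1] at this
        by_contra hc; rw [if_neg hc] at this; cases dflt <;> simp at this
      · right
        rw [Finset.mem_filter] at hx ⊢
        refine ⟨hx.1, ?_⟩
        rw [sigmaVal_cons_of_not_mem (fun hb => hdj hb (mem_pclosure.1 hx.1).2)] at hx
        exact hx.2
    · rintro (hx | hx)
      · left
        rw [Finset.mem_filter] at hx ⊢
        exact ⟨hx.1, by rw [sigmaVal_closure hx.1, if_pos hx.2]⟩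
      · right
        rw [Finset.mem_filter] at hx ⊢
        refine ⟨hx.1, ?_⟩
        rw [sigmaVal_cons_of_not_mem (fun hb => hdj hb (mem_pclosure.1 hx.1).2)]
        exact hx.2
  · exact Finset.disjoint_of_subset_left (Finset.filter_subset _ _)
      (Finset.disjoint_of_subset_right (Finset.filter_subset _ _) hdisj)

/-- The flags of a stage are as many as the variables of its `Γ` (positions and variables
correspond, the variables of the term being distinct). [cite: Thapen2022, §2] -/
theorem card_gcode {t : ℕ} {σ : PAssign n} {st : BStage n β} (hnd : VarNodup st.term) (ht : st.term.length ≤ t) :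
    (gcode blk dflt t σ st).card = ((closure blk σ st.blks).filter fun x => (x, dflt) ∈ st.term).card := by
  refine Finset.card_bij (fun j hj => (st.term[j.val]'((Finset.mem_filter.1 hj).2.1)).1) ?_ ?_ ?_
  · intro j hj
    obtain ⟨hlt, h1, h2⟩ := (Finset.mem_filter.1 hj).2
    refine Finset.mem_filter.2 ⟨h1, ?_⟩
    have : st.term[j.val] = ((st.term[j.val]).1, dflt) := by ext <;> simp [h2]
    rw [← this]; exact List.getElem_mem hlt
  · intro j hj j' hj' heq
    obtain ⟨hlt, _, _⟩ := (Finset.mem_filter.1 hj).2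
    obtain ⟨hlt', _, _⟩ := (Finset.mem_filter.1 hj').2
    have e : (st.term.map Prod.fst)[j.val]'(by simpa using hlt) = (st.term.map Prod.fst)[j'.val]'(by simpa using hlt') := by
      simpa using heq
    exact Fin.ext ((List.Nodup.getElem_inj_iff hnd).1 e)
  · intro x hx
    obtain ⟨h1, h2⟩ := Finset.mem_filter.1 hx
    obtain ⟨k, hk, hkx⟩ := List.getElem_of_mem h2
    refine ⟨⟨k, by omega⟩, Finset.mem_filter.2 ⟨Finset.mem_univ _, hk, by simp [hkx, h1], by simp [hkx]⟩, ?_⟩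
    simp [hkx]

/-- **`|Γ|` is the total number of flags** along a valid last path. [cite: Thapen2022, §2] -/
theorem card_gammaSet_eq {t : ℕ} {F : CNF (Fin n)} (hF : ∀ C ∈ F, VarNodup C) (ht : ∀ C ∈ F, C.length ≤ t) :
    ∀ {σ : PAssign n} {P : List (BStage n β)}, BPathValidLast blk dflt F σ P →
      (gammaSet blk dflt σ P).card = (((encPathB blk dflt t σ P).map Prod.snd).map Finset.card).sum
  | σ, [], h => absurd h id
  | σ, st :: rest, h => by
    have hnd := (BPathValidLast.nodup_free h).1
    obtain ⟨hC, _, _⟩ := BPathValidLast.head h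
    have hCF := mem_of_firstLive hC
    obtain ⟨hsplit, hdisj⟩ := gammaSet_cons (blk := blk) (dflt := dflt) (σ := σ) hnd
    rw [hsplit, Finset.card_union_of_disjoint hdisj, ← card_gcode (hF _ hCF) (ht _ hCF)]
    cases rest with
    | nil => simp [encPathB, gammaSet]
    | cons st' rest' =>
      rw [card_gammaSet_eq hF ht (BPathValidLast.tail h)]
      simp [encPathB]

/-! ### The code of a bad restriction and its injectivity -/

section Code

variable (F : CNF (Fin n)) (t s fuel : ℕ)

variable (blk dflt) in
/-- The chosen path of a bad restriction: a valid last path from `toPA ρ` with exactly `s` queried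
blocks (a long path, truncated). [cite: Thapen2022, §2] -/
def badPathB (ρ : BRestr n β) : List (BStage n β) :=
  if h : 1 ≤ s ∧ s ≤ bht blk dflt fuel F (toPA blk dflt ρ) then
    truncPathB (Classical.choose (exists_path_of_lt_bht (blk := blk) (dflt := dflt) F fuel (toPA blk dflt ρ)
      (s - 1) (by omega))) s
  else []

/-- The chosen path is a valid last path with `s` queried blocks. [cite: Thapen2022, §2] -/
theorem badPathB_spec {ρ : BRestr n β} (h1 : 1 ≤ s) (h : s ≤ bht blk dflt fuel F (toPA blk dflt ρ)) :
    BPathValidLast blk dflt F (toPA blk dflt ρ) (badPathB blk dflt F s fuel ρ) ∧ bplen (badPathB blk dflt F s fuel ρ) = s := by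
  unfold badPathB
  rw [dif_pos ⟨h1, h⟩]
  have hP := Classical.choose_spec (exists_path_of_lt_bht (blk := blk) (dflt := dflt) F fuel (toPA blk dflt ρ)
    (s - 1) (by omega))
  exact truncPathB_valid hP.1 h1 (by omega)

variable (blk dflt) in
/-- `ρσ` of a bad restriction. [cite: Thapen2022, §2] -/
def badStarB (ρ : BRestr n β) : BRestr n β := rhoStar blk dflt ρ (badPathB blk dflt F s fuel ρ)

variable (blk dflt) in
/-- The stage-wise code of a bad restriction. [cite: Thapen2022, §2] -/
def badEncB (ρ : BRestr n β) : List (List (Fin (t + 1) × Bool) × Finset (Fin (t + 1))) :=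
  encPathB blk dflt t (toPA blk dflt ρ) (badPathB blk dflt F s fuel ρ)

variable (blk dflt) in
/-- The letters (`β'`, `π'`) of a bad restriction, flattened with last-in-stage marks. [cite: Thapen2022, §2] -/
def badLettersB (ρ : BRestr n β) : List ((Fin (t + 1) × Bool) × Bool) :=
  flatL ((badEncB blk dflt F t s fuel ρ).map Prod.fst)

variable (blk dflt) in
/-- The flags (`γ'`) of a bad restriction, stage by stage. [cite: Thapen2022, §2] -/
def badGammasB (ρ : BRestr n β) : List (Finset (Fin (t + 1))) := (badEncB blk dflt F t s fuel ρ).map Prod.snd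

variable (blk dflt) in
/-- **The code of a bad restriction** `θ(ρ) = (β'π', γ', ρσ)` in a fixed finite type. [cite: Thapen2022, §2] -/
def badCodeB (ρ : BRestr n β) :
    (Fin s → Option ((Fin (t + 1) × Bool) × Bool)) × (Fin s → Option (Finset (Fin (t + 1)))) × BRestr n β :=
  (fun k => (badLettersB blk dflt F t s fuel ρ)[k.val]?, fun k => (badGammasB blk dflt F t s fuel ρ)[k.val]?,
    badStarB blk dflt F s fuel ρ)

/-- A list of pairs is determined by its two projections. [folklore] -/
theorem list_eq_of_map_eq {α γ : Type} : ∀ {l₁ l₂ : List (α × γ)},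
    l₁.map Prod.fst = l₂.map Prod.fst → l₁.map Prod.snd = l₂.map Prod.snd → l₁ = l₂
  | [], [], _, _ => rfl
  | [], _ :: _, h, _ => by simp at h
  | _ :: _, [], h, _ => by simp at h
  | a :: l₁, b :: l₂, h1, h2 => by
    simp only [List.map_cons, List.cons.injEq] at h1 h2
    rw [Prod.ext h1.1 h2.1, list_eq_of_map_eq h1.2 h2.2]

/-- The queried blocks of the chosen path of a bad restriction are `*`-blocks. [folklore] -/
theorem badPathB_blocks_mem {ρ : BRestr n β} (h1 : 1 ≤ s) (h : s ≤ bht blk dflt fuel F (toPA blk dflt ρ)) :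
    ∀ b ∈ bpathBlocks (badPathB blk dflt F s fuel ρ), b ∈ ρ.2 := by
  intro b hb
  obtain ⟨x, hx, rfl⟩ := (BPathValidLast.nodup_free (badPathB_spec F s fuel h1 h).1).2 b hb
  rw [free_toPA, mem_starred] at hx
  exact hx.2

/-- **The decoder recovers the free sets and the blocks of a bad restriction from its code.** [cite: Thapen2022, §2] -/
theorem decPathB_bad {ρ : BRestr n β} (hF : ∀ C ∈ F, VarNodup C) (ht : ∀ C ∈ F, C.length ≤ t) (h1 : 1 ≤ s)
    (h : s ≤ bht blk dflt fuel F (toPA blk dflt ρ)) :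
    decPathB blk dflt t F (toPA blk dflt (badStarB blk dflt F s fuel ρ)) (badEncB blk dflt F t s fuel ρ) =
      (pclosure blk (toPA blk dflt ρ) (badPathB blk dflt F s fuel ρ), (bpathBlocks (badPathB blk dflt F s fuel ρ)).toFinset) := by
  rw [badStarB, toPA_rhoStar, badEncB]
  exact decPathB_encPathB hF ht (badPathB_spec F s fuel h1 h).1 (pristine_toPA ρ)

/-- **The encoding is injective on the bad restrictions.** [cite: Thapen2022, Lemma 2] -/
theorem badCodeB_injOn [Fintype β] (hF : ∀ C ∈ F, VarNodup C) (ht : ∀ C ∈ F, C.length ≤ t) (h1 : 1 ≤ s) :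
    Set.InjOn (badCodeB blk dflt F t s fuel)
      (univ.filter fun ρ : BRestr n β => s ≤ bht blk dflt fuel F (toPA blk dflt ρ) : Finset (BRestr n β)) := by
  intro ρ₁ hρ₁ ρ₂ hρ₂ heq
  simp only [Finset.coe_filter, Finset.mem_univ, true_and, Set.mem_setOf_eq] at hρ₁ hρ₂
  simp only [badCodeB, Prod.mk.injEq] at heq
  obtain ⟨hL, hG, hS⟩ := heq
  obtain ⟨hv₁, hlen₁⟩ := badPathB_spec F s fuel h1 hρ₁
  obtain ⟨hv₂, hlen₂⟩ := badPathB_spec F s fuel h1 hρ₂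
  obtain ⟨e1, e2, e3, e4⟩ := encPathB_shape (t := t) hv₁
  obtain ⟨f1, f2, f3, f4⟩ := encPathB_shape (t := t) hv₂
  -- the letter lists and the flag lists coincide
  have hLl : badLettersB blk dflt F t s fuel ρ₁ = badLettersB blk dflt F t s fuel ρ₂ := by
    refine list_eq_of_getElem?_eq (R := s) ?_ ?_ fun k hk => congrFun hL ⟨k, hk⟩
    · rw [badLettersB, badEncB, e4, hlen₁]
    · rw [badLettersB, badEncB, f4, hlen₂]
  have hGl : badGammasB blk dflt F t s fuel ρ₁ = badGammasB blk dflt F t s fuel ρ₂ := by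
    refine list_eq_of_getElem?_eq (R := s) ?_ ?_ fun k hk => congrFun hG ⟨k, hk⟩
    · rw [badGammasB, badEncB, List.length_map, e1]; omega
    · rw [badGammasB, badEncB, List.length_map, f1]; omega
  -- hence the stage-wise codes coincide
  have hE : badEncB blk dflt F t s fuel ρ₁ = badEncB blk dflt F t s fuel ρ₂ := by
    refine list_eq_of_map_eq ?_ hGl
    have h₁ := unflatL_flatL (L := (badEncB blk dflt F t s fuel ρ₁).map Prod.fst)
      (fun l hl => by obtain ⟨c, hc, rfl⟩ := List.mem_map.1 hl; exact e3 c hc)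
    have h₂ := unflatL_flatL (L := (badEncB blk dflt F t s fuel ρ₂).map Prod.fst)
      (fun l hl => by obtain ⟨c, hc, rfl⟩ := List.mem_map.1 hl; exact f3 c hc)
    rw [← h₁, ← h₂]
    exact congrArg unflatL hLl
  -- decode both
  have hd₁ := decPathB_bad F t s fuel hF ht h1 hρ₁
  have hd₂ := decPathB_bad F t s fuel hF ht h1 hρ₂
  rw [hS, hE, hd₂, Prod.mk.injEq] at hd₁
  rw [eq_of_rhoStar (blk := blk) (dflt := dflt) ρ₁ _ (badPathB_blocks_mem F s fuel h1 hρ₁),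
    eq_of_rhoStar (blk := blk) (dflt := dflt) ρ₂ _ (badPathB_blocks_mem F s fuel h1 hρ₂)]
  change ((badStarB blk dflt F s fuel ρ₁).1 ∪ _, (badStarB blk dflt F s fuel ρ₁).2 ∪ _) =
    ((badStarB blk dflt F s fuel ρ₂).1 ∪ _, (badStarB blk dflt F s fuel ρ₂).2 ∪ _)
  rw [hS, hd₁.1, hd₁.2]

/-! ### The weight of a bad restriction -/

/-- The number of flags of a code. [cite: Thapen2022, §2] -/
def flagsB (gm : Fin s → Option (Finset (Fin (t + 1)))) : ℕ := ∑ k, ((gm k).map Finset.card).getD 0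

/-- Reading a list through `getElem?` on `Fin s` and summing gives the sum of the list. [folklore] -/
theorem sum_getD_getElem? : ∀ (s : ℕ) (l : List ℕ), l.length ≤ s → ∑ k : Fin s, (l[k.val]?).getD 0 = l.sum
  | 0, [], _ => by simp
  | 0, _ :: _, h => by simp at h
  | s + 1, [], _ => by simp
  | s + 1, a :: l, h => by
    rw [Fin.sum_univ_succ, List.sum_cons, ← sum_getD_getElem? s l (by simpa using h)]
    simp

/-- **The flags of the code count `Γ`.** [cite: Thapen2022, §2] -/
theorem flagsB_badCodeB {ρ : BRestr n β} (hF : ∀ C ∈ F, VarNodup C) (ht : ∀ C ∈ F, C.length ≤ t) (h1 : 1 ≤ s)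
    (h : s ≤ bht blk dflt fuel F (toPA blk dflt ρ)) :
    flagsB t s (badCodeB blk dflt F t s fuel ρ).2.1 =
      (gammaSet blk dflt (toPA blk dflt ρ) (badPathB blk dflt F s fuel ρ)).card := by
  obtain ⟨hv, hlen⟩ := badPathB_spec F s fuel h1 h
  obtain ⟨e1, e2, _, _⟩ := encPathB_shape (t := t) hv
  rw [card_gammaSet_eq hF ht hv, flagsB]
  have hl : ((badGammasB blk dflt F t s fuel ρ).map Finset.card).length ≤ s := by
    rw [List.length_map, badGammasB, List.length_map, badEncB, e1]; omega
  rw [← badEncB, ← badGammasB, ← sum_getD_getElem? s _ hl]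
  refine Finset.sum_congr rfl fun k _ => ?_
  simp [badCodeB, List.getElem?_map]

/-- **Weight of a bad restriction**: `(1-p)^{|Γ|} (1-q)^s w(ρ) = p^{|Γ|} q^s w(ρσ)`. [cite: Thapen2022, §2] -/
theorem weight_bad [Fintype β] (p q : ℝ) {ρ : BRestr n β} (h1 : 1 ≤ s) (h : s ≤ bht blk dflt fuel F (toPA blk dflt ρ)) :
    (1 - p) ^ (gammaSet blk dflt (toPA blk dflt ρ) (badPathB blk dflt F s fuel ρ)).card * (1 - q) ^ s * weight p q ρ =
      p ^ (gammaSet blk dflt (toPA blk dflt ρ) (badPathB blk dflt F s fuel ρ)).card * q ^ s *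
        weight p q (badStarB blk dflt F s fuel ρ) := by
  obtain ⟨hv, hlen⟩ := badPathB_spec F s fuel h1 h
  have hnd := (BPathValidLast.nodup_free hv).1
  have hs : (bpathBlocks (badPathB blk dflt F s fuel ρ)).length = s := by rw [length_bpathBlocks, hlen]
  have key := weight_rhoStar (blk := blk) (dflt := dflt) p q ρ _ hnd (badPathB_blocks_mem F s fuel h1 h)
  rw [hs] at key
  exact key

end Code

/-! ### The blockwise switching lemma -/

section Main

variable [Fintype β] (F : CNF (Fin n)) (t s fuel : ℕ)

/-- Summing the flag weights over all flag codes: `∑_{γ'} x^{|γ'|} = (1 + (1+x)^{t+1})^s`. [cite: Thapen2022, §2] -/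
theorem sum_pow_flagsB (x : ℝ) :
    ∑ gm : Fin s → Option (Finset (Fin (t + 1))), x ^ flagsB t s gm = (1 + (1 + x) ^ (t + 1)) ^ s := by
  have hprod : ∀ gm : Fin s → Option (Finset (Fin (t + 1))),
      x ^ flagsB t s gm = ∏ k, x ^ ((gm k).map Finset.card).getD 0 := by
    intro gm; rw [flagsB, Finset.prod_pow_eq_pow_sum]
  simp_rw [hprod]
  rw [← Fintype.piFinset_univ, ← Finset.prod_univ_sum (fun _ : Fin s => (univ : Finset (Option (Finset (Fin (t + 1))))))
    (fun _ o => x ^ (o.map Finset.card).getD 0), Finset.prod_const, Finset.card_univ, Fintype.card_fin]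
  congr 1
  rw [Fintype.sum_option]
  simp only [Option.map_none, Option.getD_none, pow_zero, Option.map_some, Option.getD_some]
  congr 1
  have h := Fintype.sum_pow_mul_eq_add_pow (Fin (t + 1)) x 1
  simp only [one_pow, mul_one, Fintype.card_fin] at h
  rw [h, add_comm]

/-- **The blockwise switching lemma, counting form** (Thapen 2022, Lemma 2; Håstad's second
switching lemma). For a DNF `F` over `n` variables whose terms have width `≤ t` and pairwise
distinct variables, blocks `blk`, default bit `dflt`, `0 ≤ p < 1`, `0 ≤ q < 1`, `s ≥ 1`: the total
weight of the two-stage restrictions `ρ` whose canonical block decision tree (from `toPA ρ`, any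
fuel) has height `≥ s` is at most `(4(t+1)+1)^s (1 + (1 + p/(1-p))^{t+1})^s (q/(1-q))^s`
(injection `θ`, weights transferred to `ρσ`, flags paid by `(p/(1-p))^{|Γ|}`). [cite: Thapen2022, Lemma 2] -/
theorem blockSwitching_count (hF : ∀ C ∈ F, VarNodup C) (ht : ∀ C ∈ F, C.length ≤ t) {p q : ℝ}
    (hp0 : 0 ≤ p) (hp1 : p < 1) (hq0 : 0 ≤ q) (hq1 : q < 1) (hs : 1 ≤ s) :
    ∑ ρ ∈ univ.filter (fun ρ : BRestr n β => s ≤ bht blk dflt fuel F (toPA blk dflt ρ)), weight p q ρ ≤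
      (4 * (t + 1) + 1 : ℝ) ^ s * (1 + (1 + p / (1 - p)) ^ (t + 1)) ^ s * (q / (1 - q)) ^ s := by
  classical
  set Bad := univ.filter (fun ρ : BRestr n β => s ≤ bht blk dflt fuel F (toPA blk dflt ρ)) with hBad
  have h1p : 0 < 1 - p := by linarith
  have h1q : 0 < 1 - q := by linarith
  set x := p / (1 - p) with hx
  set y := q / (1 - q) with hy
  have hx0 : 0 ≤ x := div_nonneg hp0 h1p.le
  have hy0 : 0 ≤ y := div_nonneg hq0 h1q.le
  -- the summand as a function of the code
  let Φ : (Fin s → Option ((Fin (t + 1) × Bool) × Bool)) × (Fin s → Option (Finset (Fin (t + 1)))) ×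
      BRestr n β → ℝ := fun c => x ^ flagsB t s c.2.1 * y ^ s * weight p q c.2.2
  have hΦnn : ∀ c, 0 ≤ Φ c := fun c =>
    mul_nonneg (mul_nonneg (pow_nonneg hx0 _) (pow_nonneg hy0 _)) (weight_nonneg hp0 hp1.le hq0 hq1.le _)
  -- Step 1: pointwise transfer of the weights
  have step1 : ∑ ρ ∈ Bad, weight p q ρ = ∑ ρ ∈ Bad, Φ (badCodeB blk dflt F t s fuel ρ) := by
    refine Finset.sum_congr rfl fun ρ hρ => ?_
    have hρ' : s ≤ bht blk dflt fuel F (toPA blk dflt ρ) := (Finset.mem_filter.1 hρ).2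
    have hw := weight_bad F s fuel p q hs hρ'
    simp only [Φ]
    rw [flagsB_badCodeB F t s fuel hF ht hs hρ']
    change weight p q ρ = x ^ _ * y ^ s * weight p q (badStarB blk dflt F s fuel ρ)
    set g := (gammaSet blk dflt (toPA blk dflt ρ) (badPathB blk dflt F s fuel ρ)).card with hg
    have hpp : (1 - p) ^ g * (1 - q) ^ s ≠ 0 := by positivity
    rw [hx, hy, div_pow, div_pow]
    field_simp
    linarith [hw]
  -- Step 2: injectivity
  have step2 : ∑ ρ ∈ Bad, Φ (badCodeB blk dflt F t s fuel ρ) = ∑ c ∈ Bad.image (badCodeB blk dflt F t s fuel), Φ c := by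
    rw [Finset.sum_image (badCodeB_injOn F t s fuel hF ht hs)]
  have step3 : ∑ c ∈ Bad.image (badCodeB blk dflt F t s fuel), Φ c ≤ ∑ c, Φ c :=
    Finset.sum_le_sum_of_subset_of_nonneg (Finset.subset_univ _) fun c _ _ => hΦnn c
  -- Step 4: the full sum factors
  have step4 : ∑ c, Φ c = (4 * (t + 1) + 1 : ℝ) ^ s * (1 + (1 + x) ^ (t + 1)) ^ s * y ^ s := by
    have e1 : ∑ c, Φ c = ∑ _a : Fin s → Option ((Fin (t + 1) × Bool) × Bool),
        ∑ gm : Fin s → Option (Finset (Fin (t + 1))), ∑ ρ' : BRestr n β, x ^ flagsB t s gm * y ^ s * weight p q ρ' := by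
      simp only [Φ, Fintype.sum_prod_type]
    rw [e1]
    have e2 : ∀ gm : Fin s → Option (Finset (Fin (t + 1))),
        ∑ ρ' : BRestr n β, x ^ flagsB t s gm * y ^ s * weight p q ρ' = x ^ flagsB t s gm * y ^ s := by
      intro gm; rw [← Finset.mul_sum, sum_weight, mul_one]
    simp_rw [e2]
    rw [← Finset.sum_mul, sum_pow_flagsB, Finset.sum_const, Finset.card_univ, nsmul_eq_mul]
    simp only [Fintype.card_fun, Fintype.card_option, Fintype.card_prod, Fintype.card_fin, Fintype.card_bool]
    push_cast
    ring
  rw [step1, step2]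
  exact step3.trans step4.le

/-- `(1 + 1/(t+1))^{t+1} ≤ e < 3`. [folklore] -/
theorem one_add_inv_pow_lt_three (t : ℕ) : (1 + 1 / (t + 1 : ℝ)) ^ (t + 1) < 3 := by
  have h1 : (1 + 1 / (t + 1 : ℝ)) ^ (t + 1) ≤ Real.exp 1 := by
    calc (1 + 1 / (t + 1 : ℝ)) ^ (t + 1) ≤ (Real.exp (1 / (t + 1 : ℝ))) ^ (t + 1) := by
          refine pow_le_pow_left₀ (by positivity) ?_ _
          have := Real.add_one_le_exp (1 / (t + 1 : ℝ))
          linarith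
      _ = Real.exp ((t + 1 : ℕ) * (1 / (t + 1 : ℝ))) := by rw [← Real.exp_nat_mul]
      _ = Real.exp 1 := by congr 1; push_cast; field_simp
  have h2 := Real.exp_one_lt_d9
  linarith

/-- **Håstad's blockwise switching lemma** (Thapen 2022, Lemma 2), usable form: for a DNF `F`
whose terms have width `≤ t` and pairwise distinct variables, `0 ≤ p ≤ 1/(2(t+1))`, `0 ≤ q ≤ 1/2`
and `s ≥ 1`, the probability (total weight) under the two-stage block distribution that the
canonical block decision tree of `F` from `ρ` has height `≥ s` is at most `(40 (t+1) q)^s`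
(Thapen: `(13 q r)^s`; Krajíček's statement of Håstad: `(6 q t)^s`; constants not optimised).
With `exists_dnf_of_bht_le`/`exists_cnf_of_bht_le`, outside this event `F|_{ρ g(ρ)}` is a DNF and
a CNF of width `< s`. [cite: Thapen2022, Lemma 2] [cite: Krajicek1995, Lemma 10.4.9] -/
theorem blockSwitching (hF : ∀ C ∈ F, VarNodup C) (ht : ∀ C ∈ F, C.length ≤ t) {p q : ℝ}
    (hp0 : 0 ≤ p) (hp : p ≤ 1 / (2 * (t + 1))) (hq0 : 0 ≤ q) (hq : q ≤ 1 / 2) (hs : 1 ≤ s) :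
    ∑ ρ ∈ univ.filter (fun ρ : BRestr n β => s ≤ bht blk dflt fuel F (toPA blk dflt ρ)), weight p q ρ ≤
      (40 * (t + 1) * q) ^ s := by
  have ht1 : (1 : ℝ) ≤ t + 1 := by
    have : (0 : ℝ) ≤ t := Nat.cast_nonneg t
    linarith
  have hp1 : p < 1 := by
    have : 1 / (2 * (t + 1 : ℝ)) ≤ 1 / 2 := by
      rw [div_le_div_iff₀ (by positivity) (by norm_num)]; linarith
    linarith
  have hq1 : q < 1 := by linarith
  have h := blockSwitching_count (blk := blk) (dflt := dflt) F t s fuel hF ht hp0 hp1 hq0 hq1 hs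
  refine h.trans ?_
  -- `x = p/(1-p) ≤ 1/(t+1)`
  have hx : p / (1 - p) ≤ 1 / (t + 1) := by
    rw [div_le_div_iff₀ (by linarith) (by positivity)]
    have h2 : p * (2 * (t + 1)) ≤ 1 := by
      rwa [le_div_iff₀ (by positivity)] at hp
    nlinarith
  have hx0 : 0 ≤ p / (1 - p) := div_nonneg hp0 (by linarith)
  have hmid : (1 + (1 + p / (1 - p)) ^ (t + 1)) ^ s ≤ 4 ^ s := by
    refine pow_le_pow_left₀ (by positivity) ?_ _
    have h3 : (1 + p / (1 - p)) ^ (t + 1) ≤ (1 + 1 / (t + 1 : ℝ)) ^ (t + 1) :=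
      pow_le_pow_left₀ (by positivity) (by linarith) _
    have h4 := one_add_inv_pow_lt_three t
    linarith
  have hy : (q / (1 - q)) ^ s ≤ (2 * q) ^ s := by
    refine pow_le_pow_left₀ (div_nonneg hq0 (by linarith)) ?_ _
    rw [div_le_iff₀ (by linarith)]
    nlinarith
  have h5 : (4 * (t + 1) + 1 : ℝ) ^ s ≤ (5 * (t + 1)) ^ s := pow_le_pow_left₀ (by positivity) (by linarith) _
  have key : (5 * (t + 1 : ℝ)) ^ s * 4 ^ s * (2 * q) ^ s = (40 * (t + 1) * q) ^ s := by
    rw [← mul_pow, ← mul_pow]; congr 1; ring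
  calc (4 * (t + 1) + 1 : ℝ) ^ s * (1 + (1 + p / (1 - p)) ^ (t + 1)) ^ s * (q / (1 - q)) ^ s
      ≤ (5 * (t + 1)) ^ s * 4 ^ s * (2 * q) ^ s := by
        refine mul_le_mul (mul_le_mul h5 hmid (by positivity) (by positivity)) hy (by positivity) (by positivity)
    _ = (40 * (t + 1) * q) ^ s := key

end Main

/-! ### The restriction `ρ g(ρ)` and the packaged consequences -/

variable (blk dflt) in
/-- **The restriction `ρ g(ρ)`** as a partial assignment: `toPA ρ` with, in every `*`-block, every
free variable but the least one set to the default bit. [cite: Thapen2022, §2] [cite: Krajicek1995, Def. 10.4.6] -/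
def gPA (ρ : BRestr n β) : PAssign n :=
  ⟨univ.filter fun v => ¬ IsDStar blk (toPA blk dflt ρ) v,
    fun v => if v ∈ starred blk ρ then dflt else (toPA blk dflt ρ).val v⟩

/-- The free variables of `ρ g(ρ)` are the designated variables of `toPA ρ` (the least variable of
`P` in each `*`-block). [cite: Thapen2022, §2] -/
theorem not_mem_dom_gPA_iff {ρ : BRestr n β} {v : Fin n} : v ∉ (gPA blk dflt ρ).dom ↔ IsDStar blk (toPA blk dflt ρ) v := by
  simp [gPA]

/-- **`ρ g(ρ)` followed by the input `x` is the input seen at the start of the block process.** [cite: Thapen2022, §2] -/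
theorem apply_gPA (ρ : BRestr n β) (x : Fin n → Bool) : (gPA blk dflt ρ).apply x = eff blk dflt (toPA blk dflt ρ) x := by
  funext v
  rw [apply_apply, eff]
  simp only [gPA, Finset.mem_filter, Finset.mem_univ, true_and]
  by_cases hv : v ∈ (toPA blk dflt ρ).dom
  · have hns : ¬ IsDStar blk (toPA blk dflt ρ) v := fun h => h.1 hv
    have hst : v ∉ starred blk ρ := (mem_dom_toPA blk dflt).1 hv
    rw [if_pos hns, if_pos hv, if_neg hst]
  · rw [if_neg hv]
    by_cases hds : IsDStar blk (toPA blk dflt ρ) v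
    · rw [if_neg (not_not.2 hds), if_pos hds]
    · have hst : v ∈ starred blk ρ := by rwa [mem_dom_toPA, not_not] at hv
      rw [if_pos hds, if_neg hds, if_pos hst]

/-- The number of free variables of `toPA ρ` is less than `n + 1`. [folklore] -/
theorem card_free_toPA_lt (ρ : BRestr n β) : (toPA blk dflt ρ).free.card < n + 1 := by
  have := Finset.card_le_univ (toPA blk dflt ρ).free
  rw [Fintype.card_fin] at this
  omega

/-- **Outside the bad event, `F|_{ρ g(ρ)}` is a narrow DNF**: if the block tree from `toPA ρ` (fuel
`n + 1`) has height `< s`, there is a DNF of width `< s`, with pairwise distinct variables, all free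
in `ρ g(ρ)`, computing `x ↦ F(ρ g(ρ) x)`. [cite: Thapen2022, §2] -/
theorem exists_dnf_of_bht_lt {F : CNF (Fin n)} {s : ℕ} {ρ : BRestr n β}
    (h : bht blk dflt (n + 1) F (toPA blk dflt ρ) < s) :
    ∃ D : CNF (Fin n), (∀ T ∈ D, T.length < s ∧ VarNodup T ∧ ∀ l ∈ T, l.1 ∉ (gPA blk dflt ρ).dom) ∧
      ∀ x, D.evalDNF x = F.evalDNF ((gPA blk dflt ρ).apply x) := by
  refine ⟨bdnf blk dflt (n + 1) F (toPA blk dflt ρ), fun T hT => ?_, fun x => ?_⟩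
  · obtain ⟨hnd, hds⟩ := vars_bdnf F (n + 1) _ T hT
    exact ⟨lt_of_le_of_lt (length_le_bht_of_mem_bdnf F (n + 1) _ T hT) h, hnd,
      fun l hl => not_mem_dom_gPA_iff.2 (hds l hl)⟩
  · rw [apply_gPA]; exact evalDNF_bdnf F (n + 1) _ (card_free_toPA_lt ρ) x

/-- **Outside the bad event, `F|_{ρ g(ρ)}` is a narrow CNF** (same hypotheses). [cite: Thapen2022, §2] -/
theorem exists_cnf_of_bht_lt {F : CNF (Fin n)} {s : ℕ} {ρ : BRestr n β}
    (h : bht blk dflt (n + 1) F (toPA blk dflt ρ) < s) :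
    ∃ E : CNF (Fin n), (∀ K ∈ E, K.length < s ∧ VarNodup K ∧ ∀ l ∈ K, l.1 ∉ (gPA blk dflt ρ).dom) ∧
      ∀ x, E.eval x = F.evalDNF ((gPA blk dflt ρ).apply x) := by
  refine ⟨bcnf blk dflt (n + 1) F (toPA blk dflt ρ), fun K hK => ?_, fun x => ?_⟩
  · obtain ⟨hnd, hds⟩ := vars_bcnf F (n + 1) _ K hK
    exact ⟨lt_of_le_of_lt (length_le_bht_of_mem_bcnf F (n + 1) _ K hK) h, hnd,
      fun l hl => not_mem_dom_gPA_iff.2 (hds l hl)⟩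
  · rw [apply_gPA]; exact eval_bcnf F (n + 1) _ (card_free_toPA_lt ρ) x

end BlockSwitching

end Literature.Computability.Complexity
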